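import Literature.NumberTheory.LFunctions.SiegelZeroExceptionalPrimesSecond
import Literature.NumberTheory.LFunctions.ExceptionalPrimesWindows
import Literature.NumberTheory.Sieve.BombieriAsymptoticSieveMertens
import HarnessLib

/-!
# Lacunarity of `λ = 1 ∗ χ` on rough numbers in the presence of a Siegel zero
# (Matomäki–Merikoski 2023, Lemma 4.1 and Lemma 2.2), proved

Topic `Literature/NumberTheory/LFunctions`, sub-namespace `SiegelZero` (as the siblings
`SiegelZeroExceptionalPrimes*.lean`, which prove Tao–Teräväinen's Proposition 3.5,
`TaoTeravainen2021_eq313_holds` / `TaoTeravainen2021_eq314_holds`, for an arbitrary primitive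
quadratic character). This file proves, as printed and for every `η ≥ 10`, the two lemmas of
K. Matomäki, J. Merikoski, *Siegel zeros, twin primes, Goldbach's conjecture, and primes in short
intervals* (IMRN 2023; arXiv:2112.11412) that convert an exceptional zero
`β₀ = 1 − 1/(η log q)` of `L(s, χ)` into the sparseness of `λ = 1 ∗ χ` (here the tree's real
arithmetic function `RealChar.charDivisorSum χ`, `λ(n) = ∑_{d ∣ n} χ(d) ≥ 0`) along the primes and
along the `z`-rough integers — the input of the error-term analysis (Lemma 2.1, Lemma 2.4, §7) of
their Theorem 1.3 (`Literature.Barriers.Parity.MatomakiMerikoski2023_pairCorrelation`):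

* `MatomakiMerikoski2023_lemma41_first`, `MatomakiMerikoski2023_lemma41_second` — **Lemma 4.1**
  ("essentially [TT, Proposition 3.5]"): for `δ > 0`, `Y > q^{1/2+δ}`, `k ≥ 2`,
  `∑_{q^{1/2+δ} < p ≤ Y} λ(p)/p ≪_δ log Y/(η log q)` and
  `∑_{q^{(1/2+δ)/k} < p ≤ q^{(1/2+δ)/(k−1)}} λ(p)/p ≪_δ k/η^{1/k}`; PROVED from the tree's
  Tao–Teräväinen (3.13)/(3.14) (`λ(p) = 1 + χ(p) ≤ 2·1_{χ(p) ≠ −1}`) for `η ≥ η₀(δ)` and from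
  Mertens' theorem in windows for `10 ≤ η < η₀(δ)` ("We may assume that `η` is large since
  otherwise the claims are trivial");
* `sum_rough_cardDivisors_div_le` — the standard bound (the source's (3.1)–(3.2) for `f = τ`):
  `∑_{m ≤ Y, (m, P(z)) = 1} τ(m)/m ≤ e^{10} (log Y/log z)²` for `2 ≤ z ≤ Y`
  (Euler product over the primes of `[z, Y]`, tree: `BombieriSieve.sum_le_prod_tsum_of_factored`,
  `BombieriSieve.prod_primesGe_one_sub_inv_inv_le`);
* `MatomakiMerikoski2023_lemma22` — **Lemma 2.2**: for `z = q^v`, `v > 0`, `Y > z`,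
  `∑_{z ≤ m ≤ Y, (m, P(z)) = 1} λ(m)/m ≪ (1/(v²η^{v/2}) + (v/η)(log Y/log z) + 1/z)(log Y/log z)²`
  with an ABSOLUTE constant, PROVED following §4 of the source: the squarefree `m` contribute at
  most `∏_{z ≤ p ≤ Y}(1 + λ(p)/p) − 1 ≤ exp(∑_{z ≤ p ≤ Y} λ(p)/p) − 1`, the prime sum being
  `≪ K²η^{−1/K} + log Y/(η log q)` by Lemma 4.1 with `K = ⌈(1/2+δ)/v⌉` (`δ = 1/4` fixed); the
  non-squarefree `m = p²m'` (`p ≥ z`) contribute `≪ (1/z)(log Y/log z)²`; and when the bracket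
  exceeds `1` (or `η < η₀`) the claim is the trivial bound `λ ≤ τ` with `sum_rough_cardDivisors_div_le`.

Everything here is PROVED (theorems only, no new definitions); hypotheses are inlined as in the
sibling files (`χ` primitive quadratic mod `q`, `L(1 − 1/(η log q), χ) = 0`, real `η ≥ 10`;
`q ≥ 2` is then automatic, `two_le_of_LFunction_eq_zero`). Ranges of primes `(a, b]` are
`(Ioc ⌊a⌋₊ ⌊b⌋₊).filter Nat.Prime`, the rough range `z ≤ m ≤ Y` is `Icc ⌈z⌉₊ ⌊Y⌋₊` filtered by
`m.Coprime (primesProdBelow z)` (`P(z) = ∏_{p<z} p`, `Literature.NumberTheory.Sieve.primesProdBelow`).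

Relation to the tree (coordination). A parallel seat proved the same two lemmas shortly before
this file, in `Literature/Barriers/Parity/SiegelZeroPrimePairsRoughSums.lean`
(`Literature.Barriers.Parity.MatomakiMerikoski2023_lemma22`) and `…Lemma41.lean`
(`…_lemma41_i/_ii`), rendering `λ(m)` as `(χ.zetaMul m).re` and "`(m, P(z)) = 1`" as
`∀ p ∈ m.primeFactors, z ≤ p`, with the non-squarefree `m` absorbed into the full Euler product.
The present file is the version on the sieve-framework side of the tree — `λ` is
`RealChar.charDivisorSum χ` (`RealCharacterDivisorSums*.lean`, the level-of-distribution files)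
and roughness is the filter `m.Coprime (primesProdBelow z)` of `Literature.NumberTheory.Sieve`
(`SieveFramework.lean`, `BombieriAsymptoticSieveMertens.lean`) — and it follows the printed
squarefree/non-squarefree split; the two are interchangeable through
`RealChar.charDivisorSum_eq_zetaMul_re` and `Sieve.coprime_primesProdBelow_iff`. Division of
labour (updated): the seat of `…Lemma41.lean` continued with Lemmas 3.2–3.3, (2.4)–(2.6) and
then §6 (`SiegelZeroPrimePairsChiSums{Prep,Sieve,Main}.lean`), a third seat supplies the §6
inputs in real-variable form (`LFunctions/Liouville*HarmonicSum.lean`, `MoebiusLogHarmonicSum.lean`,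
`Sieve/RoughDivisorPowerSums.lean`, `BetaSieveMainTermSigned.lean`); the seat writing this file
took §3.3–3.5 (Lemma 3.4 `PoissonTwistedProgression.lean`, Lemma 3.7 `GcdSumBounds.lean`,
Lemma 3.8 `IncompleteKloostermanSmooth.lean`), the smoothing/dyadic reduction of §2
(`Barriers/Parity/SiegelZeroPrimePairsDyadicSmoothing.lean`:
`MatomakiMerikoski2023_pairCorrelation_of_smoothed`), the weights
(`Sieve/SmoothPlateauCutoff.lean`, `Sieve/DyadicPartitionOfUnity.lean`), and continues towards
Proposition 2.3 (§5) and the assembly of §7 (Proposition 2.3, Lemma 2.1/(2.6) and Henriot's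
bound as explicit hypotheses).

## References

* K. Matomäki, J. Merikoski, *Siegel zeros, twin primes, Goldbach's conjecture, and primes in
  short intervals*, IMRN 2023:23, 20337–20384; arXiv:2112.11412: Lemma 2.2 (§2, statement),
  Lemma 4.1 and §4 "Proof of Lemma 2.2" (proofs), (3.1)–(3.2) (§3.1).
  [cite: MatomakiMerikoski2023, Lemma 2.2, Lemma 4.1, §4]
* T. Tao, J. Teräväinen, *The Hardy–Littlewood–Chowla conjecture in the presence of a Siegel
  zero*, J. London Math. Soc. 106 (2022), Proposition 3.5 (3.13)–(3.14) (tree: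
  `TaoTeravainen2021_eq313_holds`, `TaoTeravainen2021_eq314_holds`). [cite: TaoTeravainen2021, Proposition 3.5]
-/

noncomputable section

open Finset Real
open Literature.NumberTheory.LFunctions.RealChar (charDivisorSum charDivisorSum_prime
  charDivisorSum_nonneg abs_charDivisorSum_le isMultiplicative_charDivisorSum charDivisorSum_one
  charDivisorSum_apply)
open Literature.NumberTheory.LFunctions.DirichletAbel (reChar reChar_trichotomy reChar_apply
  abs_reChar_le_one)
open Literature.NumberTheory.Sieve (primesProdBelow)
open Literature.NumberTheory.Sieve.BombieriSieve (mem_primesGe prod_primesGe_one_sub_inv_inv_le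
  sum_le_prod_tsum_of_factored mem_factoredNumbers_of_rough)

namespace Literature.NumberTheory.LFunctions.SiegelZero

variable {q : ℕ}

/-! ### Bookkeeping: ranges of primes and the weight `λ(p)/p` -/

/-- The primes of `(a, b]` for real `0 ≤ a`: `{p prime : ⌊a⌋ < p ≤ ⌊b⌋} = {p ≤ ⌊b⌋ prime : a < p}`.
[folklore] -/
theorem Ioc_filter_prime_eq_primesLE_filter {a b : ℝ} (ha : 0 ≤ a) :
    (Ioc ⌊a⌋₊ ⌊b⌋₊).filter Nat.Prime = (Nat.primesLE ⌊b⌋₊).filter (fun p : ℕ => a < (p : ℝ)) := by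
  ext p
  simp only [mem_filter, mem_Ioc, Nat.mem_primesLE, Nat.floor_lt ha]
  tauto

/-- **Mertens' second theorem in a window**, `Ioc` form: for `2 ≤ a ≤ b`,
`∑_{a < p ≤ b} 1/p ≤ log log b − log log a + 8/log b + 8/log a` (the tree's
`sum_inv_prime_window_le`). [cite: HardyWright2008, Thm 427 (§22.7)] -/
theorem sum_inv_prime_Ioc_window_le {a b : ℝ} (ha : 2 ≤ a) (hab : a ≤ b) :
    ∑ p ∈ (Ioc ⌊a⌋₊ ⌊b⌋₊).filter Nat.Prime, (1 : ℝ) / p ≤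
      Real.log (Real.log b) - Real.log (Real.log a) + 8 / Real.log b + 8 / Real.log a := by
  rw [Ioc_filter_prime_eq_primesLE_filter (by linarith)]
  simpa only [one_div] using sum_inv_prime_window_le ha hab

/-- At a prime `p`, `λ(p) = 1 + χ(p) ∈ {0, 1, 2}` vanishes when `χ(p) = −1`; hence
`λ(p)/p ≤ 2 · 1_{χ(p) ≠ −1}/p` ("by non-negativity … `λ(p) = 2`" only at exceptional primes).
[cite: MatomakiMerikoski2023, §4] -/
theorem charDivisorSum_prime_div_le (χ : DirichletCharacter ℂ q) (hq : χ ^ 2 = 1) {p : ℕ}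
    (hp : p.Prime) :
    charDivisorSum χ p / p ≤ if χ (p : ZMod q) ≠ -1 then 2 / (p : ℝ) else 0 := by
  rw [charDivisorSum_prime χ hq hp]
  have hp0 : (0 : ℝ) < p := by exact_mod_cast hp.pos
  split_ifs with h
  · have h1 : reChar χ p ≤ 1 := (le_abs_self _).trans (abs_reChar_le_one χ p)
    exact div_le_div_of_nonneg_right (by linarith) hp0.le
  · push Not at h
    have h1 : reChar χ p = -1 := by rw [reChar_apply χ hp.ne_zero, h]; simp
    rw [h1]; norm_num

/-- Over any finite set `s`: `∑_{p ∈ s prime} λ(p)/p ≤ 2 ∑_{p* ∈ s exceptional} 1/p*`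
(`excPrimes`, Tao–Teräväinen's exceptional primes `χ(p*) ≠ −1`). [cite: MatomakiMerikoski2023, §4] -/
theorem sum_filter_prime_charDivisorSum_div_le (χ : DirichletCharacter ℂ q) (hq : χ ^ 2 = 1)
    (s : Finset ℕ) :
    ∑ p ∈ s.filter Nat.Prime, charDivisorSum χ p / p ≤ 2 * ∑ p ∈ excPrimes χ s, (1 : ℝ) / p := by
  classical
  calc ∑ p ∈ s.filter Nat.Prime, charDivisorSum χ p / p
      ≤ ∑ p ∈ s.filter Nat.Prime, (if χ (p : ZMod q) ≠ -1 then 2 / (p : ℝ) else 0) :=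
        sum_le_sum fun p hp => charDivisorSum_prime_div_le χ hq (mem_filter.mp hp).2
    _ = ∑ p ∈ (s.filter Nat.Prime).filter (fun p : ℕ => χ (p : ZMod q) ≠ -1), 2 / (p : ℝ) :=
        (sum_filter _ _).symm
    _ = ∑ p ∈ excPrimes χ s, 2 / (p : ℝ) := by
        refine sum_congr ?_ fun _ _ => rfl
        ext p
        simp only [mem_filter, mem_excPrimes, and_assoc]
    _ = 2 * ∑ p ∈ excPrimes χ s, (1 : ℝ) / p := by
        rw [mul_sum]
        exact sum_congr rfl fun p _ => by ring

/-- `∑_{p* ∈ s exceptional} 1/p* ≤ ∑_{p ∈ s prime} 1/p`. [folklore] -/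
theorem sum_excPrimes_le_sum_filter_prime (χ : DirichletCharacter ℂ q) (s : Finset ℕ) :
    ∑ p ∈ excPrimes χ s, (1 : ℝ) / p ≤ ∑ p ∈ s.filter Nat.Prime, (1 : ℝ) / p := by
  refine sum_le_sum_of_subset_of_nonneg (fun p hp => ?_) fun _ _ _ => by positivity
  rw [mem_excPrimes] at hp
  exact mem_filter.mpr ⟨hp.1, hp.2.1⟩

/-! ### Mertens-type "trivial" bounds for the two ranges of Lemma 4.1 -/

/-- For `q ≥ 2`, `c ≥ 1/2` and `Y > q^c`: `∑_{q^c < p ≤ Y} 1/p ≤ 50 log Y/log q` (Mertens in the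
window `(q^c, Y]`, with `log(log Y/log q^c) ≤ log Y/log q^c ≤ 2 log Y/log q`). [folklore] -/
theorem sum_inv_prime_Ioc_rpow_le {q : ℝ} (hq : 2 ≤ q) {c : ℝ} (hc : 1 / 2 ≤ c) {Y : ℝ}
    (hY : q ^ c < Y) :
    ∑ p ∈ (Ioc ⌊q ^ c⌋₊ ⌊Y⌋₊).filter Nat.Prime, (1 : ℝ) / p ≤ 50 * Real.log Y / Real.log q := by
  have hq0 : 0 < q := by linarith
  have hlogq : 0 < Real.log q := Real.log_pos (by linarith)
  have hlog2 : (0.6931471803 : ℝ) < Real.log 2 := Real.log_two_gt_d9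
  have hlogq2 : Real.log 2 ≤ Real.log q := Real.log_le_log two_pos hq
  set a : ℝ := q ^ c with ha_def
  have ha1 : 1 < a := Real.one_lt_rpow (by linarith) (by linarith)
  have hloga : Real.log a = c * Real.log q := Real.log_rpow hq0 c
  have hloga_pos : 0 < Real.log a := Real.log_pos ha1
  have hY1 : 1 < Y := ha1.trans hY
  have hlogY : 0 < Real.log Y := Real.log_pos hY1
  have hlogaY : Real.log a ≤ Real.log Y := Real.log_le_log (by linarith) hY.le
  have hRHS : 0 ≤ 50 * Real.log Y / Real.log q := by positivity
  rcases le_or_gt 2 a with ha2 | ha2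
  · -- Mertens in the window `(a, Y]`
    refine (sum_inv_prime_Ioc_window_le ha2 hY.le).trans ?_
    have h1 : Real.log (Real.log Y) - Real.log (Real.log a) ≤ Real.log Y / Real.log a := by
      rw [← Real.log_div hlogY.ne' hloga_pos.ne']
      have := Real.log_le_sub_one_of_pos (div_pos hlogY hloga_pos)
      linarith
    have h2 : 8 / Real.log Y ≤ 8 / Real.log a := div_le_div_of_nonneg_left (by norm_num) hloga_pos hlogaY
    have h3 : Real.log Y / Real.log a + 8 / Real.log a + 8 / Real.log a ≤
        50 * Real.log Y / Real.log q := by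
      have hlogY2 : Real.log 2 ≤ Real.log Y := Real.log_le_log two_pos (ha2.trans hY.le)
      have hne : Real.log a ≠ 0 := hloga_pos.ne'
      have e : Real.log Y / Real.log a + 8 / Real.log a + 8 / Real.log a =
          (Real.log Y + 16) / Real.log a := by
        field_simp
        ring
      rw [e, div_le_div_iff₀ hloga_pos hlogq, hloga]
      -- (log Y + 16) log q ≤ 50 log Y · c log q, using c ≥ 1/2 and log Y ≥ log 2 > 2/3
      have h4 : Real.log Y + 16 ≤ 25 * Real.log Y := by linarith
      have h5 : (Real.log Y + 16) * Real.log q ≤ 25 * Real.log Y * Real.log q :=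
        mul_le_mul_of_nonneg_right h4 hlogq.le
      have h6 : 25 * Real.log Y * Real.log q ≤ 50 * Real.log Y * (c * Real.log q) := by
        have : 0 ≤ Real.log Y * Real.log q := by positivity
        nlinarith
      linarith
    linarith
  · -- `a < 2`: then `q < 4`; crude Mertens `∑_{p ≤ Y} 1/p ≤ log log Y + 4`
    have hq4 : Real.log q < 2 * Real.log 2 := by
      -- `q^{1/2} ≤ q^c = a < 2`, so `(1/2) log q ≤ log a < log 2`
      have hla2 : Real.log a < Real.log 2 := Real.log_lt_log (by linarith) ha2
      rw [hloga] at hla2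
      nlinarith
    rcases lt_or_ge Y 2 with hY2 | hY2
    · -- no prime in `(a, Y] ⊆ (1, 2)`
      have hempty : (Ioc ⌊a⌋₊ ⌊Y⌋₊).filter Nat.Prime = ∅ := by
        have hfa : ⌊a⌋₊ = 1 := by
          rw [Nat.floor_eq_iff (by linarith)]; constructor <;> push_cast <;> linarith
        have hfY : ⌊Y⌋₊ = 1 := by
          rw [Nat.floor_eq_iff (by linarith)]; constructor <;> push_cast <;> linarith
        rw [hfa, hfY]; rfl
      rw [hempty, sum_empty]
      exact hRHS
    · have hfloor2 : 2 ≤ ⌊Y⌋₊ := Nat.le_floor (by exact_mod_cast hY2)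
      have hsub : (Ioc ⌊a⌋₊ ⌊Y⌋₊).filter Nat.Prime ⊆ Nat.primesLE ⌊Y⌋₊ := by
        intro p hp
        rw [mem_filter, mem_Ioc] at hp
        exact Nat.mem_primesLE.mpr ⟨hp.1.2, hp.2⟩
      calc ∑ p ∈ (Ioc ⌊a⌋₊ ⌊Y⌋₊).filter Nat.Prime, (1 : ℝ) / p
          ≤ ∑ p ∈ Nat.primesLE ⌊Y⌋₊, (1 : ℝ) / p :=
            sum_le_sum_of_subset_of_nonneg hsub fun _ _ _ => by positivity
        _ ≤ Real.log (Real.log ⌊Y⌋₊) + 4 := MertensBound.sum_inv_prime_le ⌊Y⌋₊ hfloor2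
        _ ≤ Real.log (Real.log Y) + 4 := by
            have h1 : (2 : ℝ) ≤ ⌊Y⌋₊ := by exact_mod_cast hfloor2
            have h2 : (⌊Y⌋₊ : ℝ) ≤ Y := Nat.floor_le (by linarith)
            have h3 : 0 < Real.log ⌊Y⌋₊ := Real.log_pos (by linarith)
            linarith [Real.log_le_log h3 (Real.log_le_log (by linarith) h2)]
        _ ≤ Real.log Y + 3 := by linarith [Real.log_le_sub_one_of_pos hlogY]
        _ ≤ 50 * Real.log Y / Real.log q := by
            rw [le_div_iff₀ hlogq]
            have hlogY2 : Real.log 2 ≤ Real.log Y := Real.log_le_log two_pos hY2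
            have hlog2' : Real.log 2 < 0.6931471808 := Real.log_two_lt_d9
            have h5 : (Real.log Y + 3) * Real.log q ≤ 2 * (Real.log 2 * Real.log Y) + 6 * Real.log 2 :=
              (mul_le_mul_of_nonneg_left hq4.le (by linarith)).trans_eq (by ring)
            have h6 : Real.log 2 * Real.log Y ≤ 0.6931471808 * Real.log Y :=
              mul_le_mul_of_nonneg_right hlog2'.le hlogY.le
            linarith

/-- For `q ≥ 2`, `c > 0`, `k ≥ 2`: `∑_{q^{c/k} < p ≤ q^{c/(k−1)}} 1/p ≤ 24` (Mertens in the window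
when `q^{c/k} ≥ 2`: `log(k/(k−1)) + 16/log 2`; otherwise the window lies below `4`). [folklore] -/
theorem sum_inv_prime_Ioc_window_rpow_le {q : ℝ} (hq : 2 ≤ q) {c : ℝ} (hc : 0 < c) {k : ℕ}
    (hk : 2 ≤ k) :
    ∑ p ∈ (Ioc ⌊q ^ (c / k)⌋₊ ⌊q ^ (c / ((k : ℝ) - 1))⌋₊).filter Nat.Prime, (1 : ℝ) / p ≤ 24 := by
  have hq0 : 0 < q := by linarith
  have hq1 : 1 ≤ q := by linarith
  have hlogq : 0 < Real.log q := Real.log_pos (by linarith)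
  have hlog2 : (0.6931471803 : ℝ) < Real.log 2 := Real.log_two_gt_d9
  have hlog2' : Real.log 2 < 0.6931471808 := Real.log_two_lt_d9
  have hk' : (2 : ℝ) ≤ k := by exact_mod_cast hk
  have hk0 : (0 : ℝ) < k := by linarith
  have hk1 : (0 : ℝ) < (k : ℝ) - 1 := by linarith
  set A : ℝ := q ^ (c / k) with hA_def
  set B : ℝ := q ^ (c / ((k : ℝ) - 1)) with hB_def
  have hA1 : 1 ≤ A := Real.one_le_rpow hq1 (by positivity)
  have hexp_le : c / k ≤ c / ((k : ℝ) - 1) := div_le_div_of_nonneg_left hc.le hk1 (by linarith)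
  have hAB : A ≤ B := Real.rpow_le_rpow_of_exponent_le hq1 hexp_le
  have hlogA : Real.log A = c / k * Real.log q := Real.log_rpow hq0 _
  have hlogB : Real.log B = c / ((k : ℝ) - 1) * Real.log q := Real.log_rpow hq0 _
  rcases le_or_gt 2 A with hA2 | hA2
  · refine (sum_inv_prime_Ioc_window_le hA2 hAB).trans ?_
    have hlogA_pos : 0 < Real.log A := Real.log_pos (by linarith)
    have hlogB_pos : 0 < Real.log B := by rw [hlogB]; positivity
    have hratio : Real.log B / Real.log A = k / ((k : ℝ) - 1) := by
      rw [hlogA, hlogB]; field_simp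
    have h1 : Real.log (Real.log B) - Real.log (Real.log A) ≤ Real.log 2 := by
      rw [← Real.log_div hlogB_pos.ne' hlogA_pos.ne', hratio]
      refine Real.log_le_log (by positivity) ?_
      rw [div_le_iff₀ hk1]; linarith
    have hlogA2 : Real.log 2 ≤ Real.log A := Real.log_le_log two_pos hA2
    have hlogB2 : Real.log 2 ≤ Real.log B := hlogA2.trans (Real.log_le_log (by linarith) hAB)
    have h2 : 8 / Real.log A ≤ 8 / Real.log 2 := div_le_div_of_nonneg_left (by norm_num) (by linarith) hlogA2
    have h3 : 8 / Real.log B ≤ 8 / Real.log 2 := div_le_div_of_nonneg_left (by norm_num) (by linarith) hlogB2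
    have h4 : 8 / Real.log 2 ≤ 11.6 := by rw [div_le_iff₀ (by linarith)]; linarith
    linarith
  · -- `A < 2`: `B = A^{k/(k-1)} < 2^{k/(k-1)} ≤ 4`, so the window only contains `2` and `3`
    have hB4 : B < 4 := by
      have hBA : B = A ^ ((k : ℝ) / ((k : ℝ) - 1)) := by
        rw [hA_def, hB_def, ← Real.rpow_mul hq0.le]
        congr 1; field_simp
      have hr0 : 0 < (k : ℝ) / ((k : ℝ) - 1) := by positivity
      have hr2 : (k : ℝ) / ((k : ℝ) - 1) ≤ 2 := by rw [div_le_iff₀ hk1]; linarith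
      calc B = A ^ ((k : ℝ) / ((k : ℝ) - 1)) := hBA
        _ < 2 ^ ((k : ℝ) / ((k : ℝ) - 1)) := Real.rpow_lt_rpow (by linarith) hA2 hr0
        _ ≤ 2 ^ (2 : ℝ) := Real.rpow_le_rpow_of_exponent_le (by norm_num) hr2
        _ = 4 := by norm_num [Real.rpow_two]
    have hsub : (Ioc ⌊A⌋₊ ⌊B⌋₊).filter Nat.Prime ⊆ {2, 3} := by
      intro p hp
      rw [mem_filter, mem_Ioc] at hp
      have hp3 : p ≤ 3 := by
        have h1 : (p : ℝ) ≤ ⌊B⌋₊ := by exact_mod_cast hp.1.2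
        have h2 : (⌊B⌋₊ : ℝ) ≤ B := Nat.floor_le (by linarith)
        have h3 : (p : ℝ) < 4 := by linarith
        have h4 : p < 4 := by exact_mod_cast h3
        omega
      have hp2 : 2 ≤ p := hp.2.two_le
      interval_cases p
      · simp
      · simp
    calc ∑ p ∈ (Ioc ⌊A⌋₊ ⌊B⌋₊).filter Nat.Prime, (1 : ℝ) / p ≤ ∑ p ∈ ({2, 3} : Finset ℕ), (1 : ℝ) / p :=
          sum_le_sum_of_subset_of_nonneg hsub fun _ _ _ => by positivity
      _ ≤ 24 := by rw [sum_pair (by norm_num)]; norm_num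

/-! ### Lemma 4.1 -/

/-- **Matomäki–Merikoski 2023, Lemma 4.1, first bound** ("Let `χ` be a primitive quadratic
character modulo `q ≥ 2`. Assume that `L(s, χ)` has a real zero `β₀ = 1 − 1/(η log q)` for some
`η ≥ 10`. Let `δ > 0`. Then, for any `Y > q^{1/2+δ}`, one has
`∑_{q^{1/2+δ} < p ≤ Y} λ(p)/p ≪_δ log Y/(η log q)`"), `λ = 1 ∗ χ`, PROVED: for `η ≥ η₀(δ)` this is
Tao–Teräväinen's (3.13) (`TaoTeravainen2021_eq313_holds`, `λ(p) ≤ 2·1_{χ(p) ≠ −1}`), and for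
`10 ≤ η < η₀(δ)` it is Mertens' theorem ("We may assume that `η` is large since otherwise the
claims are trivial"). [cite: MatomakiMerikoski2023, Lemma 4.1] -/
theorem MatomakiMerikoski2023_lemma41_first {δ : ℝ} (hδ : 0 < δ) :
    ∃ K : ℝ, 0 < K ∧ ∀ (q : ℕ) [NeZero q] (χ : DirichletCharacter ℂ q), χ.IsPrimitive →
      χ.IsQuadratic → ∀ η : ℝ, 10 ≤ η → χ.LFunction ((1 - 1 / (η * Real.log q) : ℝ) : ℂ) = 0 →
      ∀ Y : ℝ, (q : ℝ) ^ (1 / 2 + δ) < Y →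
        ∑ p ∈ (Ioc ⌊(q : ℝ) ^ (1 / 2 + δ)⌋₊ ⌊Y⌋₊).filter Nat.Prime, charDivisorSum χ p / p ≤
          K * Real.log Y / (η * Real.log q) := by
  obtain ⟨K₁, η₁, H₁⟩ := TaoTeravainen2021_eq313_holds (2 * δ) (by positivity)
  refine ⟨max (max (2 * K₁) (100 * η₁)) 1, by positivity, ?_⟩
  intro q _ χ hprim hquad η hη hL Y hY
  have hq2 : (2 : ℝ) ≤ q := by exact_mod_cast two_le_of_LFunction_eq_zero hL
  have hqpos : (0 : ℝ) < q := by linarith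
  have hlogq : 0 < Real.log q := Real.log_pos (by linarith)
  have hη0 : 0 < η := by linarith
  have hsq : χ ^ 2 = 1 := MulChar.isQuadratic_iff_sq_eq_one.mp hquad
  have ha1 : 1 < (q : ℝ) ^ (1 / 2 + δ) := Real.one_lt_rpow (by linarith) (by linarith)
  have hY1 : 1 < Y := ha1.trans hY
  have hlogY : 0 < Real.log Y := Real.log_pos hY1
  have ht : 0 ≤ Real.log Y / (η * Real.log q) := by positivity
  have hexc := sum_filter_prime_charDivisorSum_div_le χ hsq (Ioc ⌊(q : ℝ) ^ (1 / 2 + δ)⌋₊ ⌊Y⌋₊)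
  have hexp : (1 + 2 * δ) / 2 = 1 / 2 + δ := by ring
  rcases le_or_gt η₁ η with hη₁ | hη₁
  · have h := H₁ q χ hprim hquad η hη₁ hL Y (by rw [hexp]; exact hY.le)
    rw [hexp] at h
    have hK : 2 * K₁ ≤ max (max (2 * K₁) (100 * η₁)) 1 := le_max_of_le_left (le_max_left _ _)
    calc _ ≤ 2 * ∑ p ∈ excPrimes χ (Ioc ⌊(q : ℝ) ^ (1 / 2 + δ)⌋₊ ⌊Y⌋₊), (1 : ℝ) / p := hexc
      _ ≤ 2 * (K₁ * (Real.log Y / Real.log q) / η) := by linarith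
      _ = (2 * K₁) * (Real.log Y / (η * Real.log q)) := by field_simp
      _ ≤ max (max (2 * K₁) (100 * η₁)) 1 * (Real.log Y / (η * Real.log q)) :=
          mul_le_mul_of_nonneg_right hK ht
      _ = max (max (2 * K₁) (100 * η₁)) 1 * Real.log Y / (η * Real.log q) := by ring
  · have htriv := sum_inv_prime_Ioc_rpow_le hq2 (c := 1 / 2 + δ) (by linarith) hY
    have hsub := sum_excPrimes_le_sum_filter_prime χ (Ioc ⌊(q : ℝ) ^ (1 / 2 + δ)⌋₊ ⌊Y⌋₊)
    have hK : 100 * η₁ ≤ max (max (2 * K₁) (100 * η₁)) 1 := le_max_of_le_left (le_max_right _ _)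
    calc _ ≤ 2 * ∑ p ∈ excPrimes χ (Ioc ⌊(q : ℝ) ^ (1 / 2 + δ)⌋₊ ⌊Y⌋₊), (1 : ℝ) / p := hexc
      _ ≤ 2 * (50 * Real.log Y / Real.log q) := by linarith
      _ = (100 * η) * (Real.log Y / (η * Real.log q)) := by field_simp; ring
      _ ≤ (100 * η₁) * (Real.log Y / (η * Real.log q)) := by
          refine mul_le_mul_of_nonneg_right ?_ ht; linarith
      _ ≤ max (max (2 * K₁) (100 * η₁)) 1 * (Real.log Y / (η * Real.log q)) :=
          mul_le_mul_of_nonneg_right hK ht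
      _ = max (max (2 * K₁) (100 * η₁)) 1 * Real.log Y / (η * Real.log q) := by ring

/-- **Matomäki–Merikoski 2023, Lemma 4.1, second bound** ("and, for any `k ≥ 2`, one has
`∑_{q^{(1/2+δ)/k} < p ≤ q^{(1/2+δ)/(k−1)}} λ(p)/p ≪_δ k/η^{1/k}`"), same hypotheses, PROVED: for
`η ≥ η₀(δ)` this is Tao–Teräväinen's (3.14) (`TaoTeravainen2021_eq314_holds`), and for
`10 ≤ η < η₀(δ)` the window sum is `≤ 24 ≤ (12 η₀) k/η^{1/k}`. [cite: MatomakiMerikoski2023, Lemma 4.1] -/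
theorem MatomakiMerikoski2023_lemma41_second {δ : ℝ} (hδ : 0 < δ) :
    ∃ K : ℝ, 0 < K ∧ ∀ (q : ℕ) [NeZero q] (χ : DirichletCharacter ℂ q), χ.IsPrimitive →
      χ.IsQuadratic → ∀ η : ℝ, 10 ≤ η → χ.LFunction ((1 - 1 / (η * Real.log q) : ℝ) : ℂ) = 0 →
      ∀ k : ℕ, 2 ≤ k →
        ∑ p ∈ (Ioc ⌊(q : ℝ) ^ ((1 / 2 + δ) / k)⌋₊ ⌊(q : ℝ) ^ ((1 / 2 + δ) / ((k : ℝ) - 1))⌋₊).filter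
            Nat.Prime, charDivisorSum χ p / p ≤ K * k / η ^ ((1 : ℝ) / k) := by
  obtain ⟨K₂, η₂, H₂⟩ := TaoTeravainen2021_eq314_holds (2 * δ) (by positivity)
  refine ⟨max (max (2 * K₂) (24 * η₂)) 1, by positivity, ?_⟩
  intro q _ χ hprim hquad η hη hL k hk
  have hq2 : (2 : ℝ) ≤ q := by exact_mod_cast two_le_of_LFunction_eq_zero hL
  have hη0 : 0 < η := by linarith
  have hη1 : 1 ≤ η := by linarith
  have hsq : χ ^ 2 = 1 := MulChar.isQuadratic_iff_sq_eq_one.mp hquad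
  have hk' : (2 : ℝ) ≤ k := by exact_mod_cast hk
  have hk0 : (0 : ℝ) < k := by linarith
  set s := Ioc ⌊(q : ℝ) ^ ((1 / 2 + δ) / k)⌋₊ ⌊(q : ℝ) ^ ((1 / 2 + δ) / ((k : ℝ) - 1))⌋₊ with hs
  have hexc := sum_filter_prime_charDivisorSum_div_le χ hsq s
  have h12 : (1 : ℝ) + 2 * δ = 2 * (1 / 2 + δ) := by ring
  have hexp1 : (1 + 2 * δ) / (2 * k) = (1 / 2 + δ) / k := by
    rw [h12, mul_div_mul_left _ _ two_ne_zero]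
  have hexp2 : (1 + 2 * δ) / (2 * ((k : ℝ) - 1)) = (1 / 2 + δ) / ((k : ℝ) - 1) := by
    rw [h12, mul_div_mul_left _ _ two_ne_zero]
  have hηk : 0 < η ^ ((1 : ℝ) / k) := Real.rpow_pos_of_pos hη0 _
  have ht : 0 ≤ (k : ℝ) / η ^ ((1 : ℝ) / k) := by positivity
  rcases le_or_gt η₂ η with hη₂ | hη₂
  · have h := H₂ q χ hprim hquad η hη₂ hL k hk
    rw [hexp1, hexp2] at h
    have hK : 2 * K₂ ≤ max (max (2 * K₂) (24 * η₂)) 1 := le_max_of_le_left (le_max_left _ _)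
    calc _ ≤ 2 * ∑ p ∈ excPrimes χ s, (1 : ℝ) / p := hexc
      _ ≤ 2 * (K₂ * k / η ^ ((1 : ℝ) / k)) := by linarith
      _ = (2 * K₂) * ((k : ℝ) / η ^ ((1 : ℝ) / k)) := by ring
      _ ≤ max (max (2 * K₂) (24 * η₂)) 1 * ((k : ℝ) / η ^ ((1 : ℝ) / k)) :=
          mul_le_mul_of_nonneg_right hK ht
      _ = max (max (2 * K₂) (24 * η₂)) 1 * k / η ^ ((1 : ℝ) / k) := by ring
  · have htriv := sum_inv_prime_Ioc_window_rpow_le hq2 (c := 1 / 2 + δ) (by linarith) hk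
    have hsub := sum_excPrimes_le_sum_filter_prime χ s
    have hK : 24 * η₂ ≤ max (max (2 * K₂) (24 * η₂)) 1 := le_max_of_le_left (le_max_right _ _)
    -- `η^{1/k} ≤ η`, so `k/η^{1/k} ≥ 2/η`
    have hpow : η ^ ((1 : ℝ) / k) ≤ η := by
      conv_rhs => rw [← Real.rpow_one η]
      refine Real.rpow_le_rpow_of_exponent_le hη1 ?_
      rw [div_le_iff₀ hk0]; linarith
    have hlow : 2 / η ≤ (k : ℝ) / η ^ ((1 : ℝ) / k) := by
      rw [div_le_div_iff₀ hη0 hηk]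
      nlinarith
    calc _ ≤ 2 * ∑ p ∈ excPrimes χ s, (1 : ℝ) / p := hexc
      _ ≤ 2 * 24 := by linarith
      _ = (24 * η) * (2 / η) := by field_simp
      _ ≤ (24 * η₂) * (2 / η) := by
          refine mul_le_mul_of_nonneg_right ?_ (by positivity); linarith
      _ ≤ (24 * η₂) * ((k : ℝ) / η ^ ((1 : ℝ) / k)) := by
          refine mul_le_mul_of_nonneg_left hlow ?_
          -- `η₂ > η ≥ 10 > 0`
          linarith
      _ ≤ max (max (2 * K₂) (24 * η₂)) 1 * ((k : ℝ) / η ^ ((1 : ℝ) / k)) :=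
          mul_le_mul_of_nonneg_right hK ht
      _ = max (max (2 * K₂) (24 * η₂)) 1 * k / η ^ ((1 : ℝ) / k) := by ring

/-! ### Generic tools: covers, squarefree expansions, divisor counts -/

/-- Union bound: if every element of `s` lies in some `r j`, `j ∈ J`, then for a non-negative `f`,
`∑_{a ∈ s} f a ≤ ∑_{j ∈ J} ∑_{a ∈ r j} f a`. [folklore] -/
theorem sum_le_sum_sum_of_cover {ι α : Type*} [DecidableEq α] (s : Finset α) (J : Finset ι)
    (r : ι → Finset α) (f : α → ℝ) (hf : ∀ a, 0 ≤ f a)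
    (hcover : ∀ a ∈ s, ∃ j ∈ J, a ∈ r j) :
    ∑ a ∈ s, f a ≤ ∑ j ∈ J, ∑ a ∈ r j, f a := by
  classical
  calc ∑ a ∈ s, f a ≤ ∑ a ∈ s, ∑ j ∈ J, (if a ∈ r j then f a else 0) := by
        refine sum_le_sum fun a ha => ?_
        obtain ⟨j, hj, haj⟩ := hcover a ha
        calc f a = (if a ∈ r j then f a else 0) := by rw [if_pos haj]
          _ ≤ ∑ j ∈ J, (if a ∈ r j then f a else 0) :=
              single_le_sum (f := fun j => if a ∈ r j then f a else 0)
                (fun i _ => ite_nonneg (hf a) le_rfl) hj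
    _ = ∑ j ∈ J, ∑ a ∈ s, (if a ∈ r j then f a else 0) := sum_comm
    _ = ∑ j ∈ J, ∑ a ∈ s.filter (· ∈ r j), f a :=
        sum_congr rfl fun j _ => (sum_filter _ _).symm
    _ ≤ ∑ j ∈ J, ∑ a ∈ r j, f a := by
        refine sum_le_sum fun j _ => sum_le_sum_of_subset_of_nonneg (fun a ha => ?_)
          fun a _ _ => hf a
        exact (mem_filter.mp ha).2

/-- For a multiplicative real arithmetic function `f`, non-negative on a finite set of primes `P`,
and a finite set `S` of squarefree integers `m ≠ 1` all of whose prime factors lie in `P`: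
`∑_{m ∈ S} f(m) ≤ ∏_{p ∈ P} (1 + f(p)) − 1` (expand the product over subsets of `P`;
`m ↦ primeFactors m` is injective on squarefree numbers and misses `∅`). This is the step
"`∑_{z ≤ m ≤ Y, (m,P(z))=1} |μ(m)|λ(m)/m ≤ ∏_{z ≤ p ≤ Y}(1 + λ(p)/p) − 1`" of the source.
[cite: MatomakiMerikoski2023, §4 eq. (4.7)] -/
theorem sum_squarefree_le_prod_one_add_sub_one {f : ArithmeticFunction ℝ} (hf : f.IsMultiplicative)
    {P S : Finset ℕ} (hP : ∀ p ∈ P, 0 ≤ f p)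
    (hS : ∀ m ∈ S, Squarefree m ∧ m ≠ 1 ∧ m.primeFactors ⊆ P) :
    ∑ m ∈ S, f m ≤ ∏ p ∈ P, (1 + f p) - 1 := by
  classical
  rw [prod_one_add]
  have hinj : Set.InjOn Nat.primeFactors (S : Set ℕ) := by
    intro m₁ h₁ m₂ h₂ heq
    have e₁ := Nat.prod_primeFactors_of_squarefree (hS m₁ h₁).1
    have e₂ := Nat.prod_primeFactors_of_squarefree (hS m₂ h₂).1
    rw [← e₁, ← e₂]
    exact congrArg (fun t : Finset ℕ => ∏ p ∈ t, p) heq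
  have hsum : ∑ m ∈ S, f m = ∑ t ∈ S.image Nat.primeFactors, ∏ p ∈ t, f p := by
    rw [sum_image hinj]
    exact sum_congr rfl fun m hm => (hf.prod_primeFactors (hS m hm).1).symm
  rw [hsum]
  have hsub : S.image Nat.primeFactors ⊆ P.powerset.erase ∅ := by
    intro t ht
    obtain ⟨m, hm, rfl⟩ := mem_image.mp ht
    rw [mem_erase, mem_powerset]
    refine ⟨?_, (hS m hm).2.2⟩
    have hm0 : m ≠ 0 := (hS m hm).1.ne_zero
    have hm1 : m ≠ 1 := (hS m hm).2.1
    have hne : m.primeFactors.Nonempty := Nat.nonempty_primeFactors.mpr (by omega)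
    exact hne.ne_empty
  have hnonneg : ∀ t ∈ P.powerset.erase ∅, 0 ≤ ∏ p ∈ t, f p := fun t ht =>
    prod_nonneg fun p hp => hP p (mem_powerset.mp (mem_erase.mp ht).2 hp)
  calc ∑ t ∈ S.image Nat.primeFactors, ∏ p ∈ t, f p
      ≤ ∑ t ∈ P.powerset.erase ∅, ∏ p ∈ t, f p :=
        sum_le_sum_of_subset_of_nonneg hsub fun t ht _ => hnonneg t ht
    _ = ∑ t ∈ P.powerset, ∏ p ∈ t, f p - 1 := by
        rw [← sum_erase_add _ _ (empty_mem_powerset P), prod_empty]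
        ring

/-- `∏_{p ∈ P} (1 + f(p)) − 1 ≤ exp(∑_{p ∈ P} f(p)) − 1` for `f ≥ 0` on `P` ("`≤ ∏ exp(λ(p)/p) − 1
= exp(∑ λ(p)/p) − 1`"). [cite: MatomakiMerikoski2023, §4 eq. (4.7)] -/
theorem prod_one_add_le_exp_sum {P : Finset ℕ} {f : ℕ → ℝ} (hP : ∀ p ∈ P, 0 ≤ f p) :
    ∏ p ∈ P, (1 + f p) ≤ Real.exp (∑ p ∈ P, f p) := by
  rw [Real.exp_sum]
  exact prod_le_prod (fun p hp => by linarith [hP p hp]) fun p _ => by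
    linarith [Real.add_one_le_exp (f p)]

/-- The divisors of `p² m` number at most `3 τ(m)` (`τ(ab) ≤ τ(a)τ(b)`: every divisor of `ab`
is a product of a divisor of `a` and a divisor of `b`; `τ(p²) = 3`). [folklore] -/
theorem card_divisors_prime_sq_mul_le {p : ℕ} (hp : p.Prime) (m : ℕ) :
    #(p ^ 2 * m).divisors ≤ 3 * #m.divisors := by
  classical
  have hτ : #(p ^ 2).divisors = 3 := by
    rw [← ArithmeticFunction.sigma_zero_apply, ArithmeticFunction.sigma_zero_apply_prime_pow hp]
  rw [← hτ]
  set a := p ^ 2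
  have hsub : (a * m).divisors ⊆ (a.divisors ×ˢ m.divisors).image (fun x => x.1 * x.2) := by
    intro d hd
    rw [Nat.mem_divisors] at hd
    obtain ⟨hd, hab⟩ := hd
    obtain ⟨y, z, hy, hz, rfl⟩ := Nat.dvd_mul.mp hd
    have ha : a ≠ 0 := left_ne_zero_of_mul hab
    have hb : m ≠ 0 := right_ne_zero_of_mul hab
    exact mem_image.mpr ⟨(y, z), mem_product.mpr
      ⟨Nat.mem_divisors.mpr ⟨hy, ha⟩, Nat.mem_divisors.mpr ⟨hz, hb⟩⟩, rfl⟩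
  calc #(a * m).divisors ≤ #((a.divisors ×ˢ m.divisors).image (fun x => x.1 * x.2)) :=
        card_le_card hsub
    _ ≤ #(a.divisors ×ˢ m.divisors) := card_image_le
    _ = #a.divisors * #m.divisors := card_product _ _

/-- For `z ≤ 2` every natural number is `z`-rough: `P(z) = 1` (no prime is `< 2`), in the form
`m.Coprime (primesProdBelow z)`. [folklore] -/
theorem coprime_primesProdBelow_of_le_two {z : ℝ} (hz : z ≤ 2) (m : ℕ) :
    m.Coprime (primesProdBelow z) := by
  have h : primesProdBelow z = 1 := by
    rw [primesProdBelow]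
    have h1 : Nat.primesBelow ⌈z⌉₊ = ∅ := by
      ext p
      simp only [Nat.mem_primesBelow, Finset.notMem_empty, iff_false, not_and]
      intro hp hprime
      have h2 := hprime.two_le
      have h3 : ⌈z⌉₊ ≤ 2 := Nat.ceil_le.mpr (by exact_mod_cast hz)
      omega
    rw [h1, prod_empty]
  rw [h]
  exact Nat.coprime_one_right m

/-- A prime divisor of a `z`-rough number is `≥ z`. [folklore] -/
theorem le_of_dvd_of_coprime_primesProdBelow {z : ℝ} {m p : ℕ} (hp : p.Prime) (hpm : p ∣ m)
    (hm : m.Coprime (primesProdBelow z)) : z ≤ (p : ℝ) := by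
  by_contra h
  rw [not_le] at h
  have h1 : p ∣ primesProdBelow z := (Literature.NumberTheory.Sieve.dvd_primesProdBelow_iff hp z).mpr h
  have h2 : p ∣ Nat.gcd m (primesProdBelow z) := Nat.dvd_gcd hpm h1
  rw [hm] at h2
  exact hp.one_lt.ne' (Nat.dvd_one.mp h2)

/-! ### Divisor sums over rough numbers: the source's (3.1)–(3.2) for `f = τ` -/

/-- **`∑_{d ≤ x, (d, P(z)) = 1} τ(d)/d ≤ (e⁵ log x / log z)²`** for `2 ≤ z ≤ x`: the sum of the
non-negative multiplicative `τ(d)/d` over the `z`-rough `d ≤ x` is at most the Euler product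
`∏_{z ≤ p ≤ x} ∑_e (e+1)/p^e = ∏_{z ≤ p ≤ x} (1 − 1/p)⁻²`, and Mertens
(`BombieriSieve.prod_primesGe_one_sub_inv_inv_le`). This is (3.1) with (3.2) (`k = 2`) of the
source for `f = τ·1_{(·,P(z))=1}`. [cite: MatomakiMerikoski2023, §3.1 eqs. (3.1)–(3.2)] -/
theorem sum_rough_cardDivisors_div_le {z x : ℝ} (hz : 2 ≤ z) (hzx : z ≤ x) :
    ∑ d ∈ (Ioc 0 ⌊x⌋₊).filter (fun d : ℕ => d.Coprime (primesProdBelow z)),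
        (#d.divisors : ℝ) / d ≤ (Real.exp 5 * Real.log x / Real.log z) ^ 2 := by
  set h : ℕ → ℝ := fun n => (#n.divisors : ℝ) / n with hh
  have h1 : h 1 = 1 := by simp [hh]
  have hmul : ∀ {m n : ℕ}, Nat.Coprime m n → h (m * n) = h m * h n := by
    intro m n hmn
    simp only [hh, Nat.Coprime.card_divisors_mul hmn, Nat.cast_mul, mul_div_mul_comm]
  have h0 : ∀ n, 0 ≤ h n := fun n => by positivity
  have hgeom : ∀ {p : ℕ}, p.Prime → HasSum (fun e : ℕ => h (p ^ e)) ((1 - (p : ℝ)⁻¹)⁻¹ ^ 2) := by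
    intro p hp
    have hp1 : (1 : ℝ) < p := by exact_mod_cast hp.one_lt
    have hp0 : (0 : ℝ) < p := by linarith
    have hr0 : (0 : ℝ) ≤ (p : ℝ)⁻¹ := by positivity
    have hr1 : (p : ℝ)⁻¹ < 1 := inv_lt_one_of_one_lt₀ hp1
    have hnorm : ‖(p : ℝ)⁻¹‖ < 1 := by rw [Real.norm_of_nonneg hr0]; exact hr1
    have hA := hasSum_coe_mul_geometric_of_norm_lt_one hnorm
    have hB := hasSum_geometric_of_lt_one hr0 hr1
    have hne : (1 : ℝ) - (p : ℝ)⁻¹ ≠ 0 := (sub_pos.mpr hr1).ne'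
    have heq : (p : ℝ)⁻¹ / (1 - (p : ℝ)⁻¹) ^ 2 + (1 - (p : ℝ)⁻¹)⁻¹ = (1 - (p : ℝ)⁻¹)⁻¹ ^ 2 := by
      field_simp
      ring
    have hAB := hA.add hB
    rw [heq] at hAB
    refine hAB.congr_fun fun e => ?_
    show (#(p ^ e).divisors : ℝ) / ((p ^ e : ℕ) : ℝ) = (e : ℝ) * (p : ℝ)⁻¹ ^ e + (p : ℝ)⁻¹ ^ e
    rw [← ArithmeticFunction.sigma_zero_apply, ArithmeticFunction.sigma_zero_apply_prime_pow hp,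
      Nat.cast_pow, inv_pow, div_eq_mul_inv]
    push_cast
    ring
  calc ∑ d ∈ (Ioc 0 ⌊x⌋₊).filter (fun d : ℕ => d.Coprime (primesProdBelow z)), h d
      ≤ ∏ p ∈ (Nat.primesLE ⌊x⌋₊).filter (fun p : ℕ => z ≤ (p : ℝ)), ∑' e : ℕ, h (p ^ e) :=
        sum_le_prod_tsum_of_factored h1 (fun {m n} hmn => hmul hmn) h0
          (fun hp => (hgeom hp).summable) (fun p hp => (mem_primesGe.mp hp).1)
          (fun d hd => mem_factoredNumbers_of_rough hd)
    _ = ∏ p ∈ (Nat.primesLE ⌊x⌋₊).filter (fun p : ℕ => z ≤ (p : ℝ)), (1 - (p : ℝ)⁻¹)⁻¹ ^ 2 :=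
        prod_congr rfl fun p hp => (hgeom (mem_primesGe.mp hp).1).tsum_eq
    _ = (∏ p ∈ (Nat.primesLE ⌊x⌋₊).filter (fun p : ℕ => z ≤ (p : ℝ)), (1 - (p : ℝ)⁻¹)⁻¹) ^ 2 :=
        prod_pow _ 2 _
    _ ≤ (Real.exp 5 * Real.log x / Real.log z) ^ 2 := by
        refine pow_le_pow_left₀ (prod_nonneg fun p hp => ?_) (prod_primesGe_one_sub_inv_inv_le hz hzx) 2
        have hp1 : (1 : ℝ) < p := by exact_mod_cast (mem_primesGe.mp hp).1.one_lt
        exact inv_nonneg.mpr (sub_nonneg.mpr (inv_le_one_of_one_le₀ hp1.le))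

/-- The same bound for every `1 < z ≤ Y`, with the constant `e^{10}`:
`∑_{d ≤ Y, (d, P(z)) = 1} τ(d)/d ≤ e^{10} (log Y / log z)²` (for `z < 2` every `d` is `z`-rough
and `log Y/log z ≥ log Y/log 2`). [cite: MatomakiMerikoski2023, §3.1 eqs. (3.1)–(3.2)] -/
theorem sum_rough_cardDivisors_div_le' {z Y : ℝ} (hz : 1 < z) (hzY : z ≤ Y) :
    ∑ d ∈ (Ioc 0 ⌊Y⌋₊).filter (fun d : ℕ => d.Coprime (primesProdBelow z)),
        (#d.divisors : ℝ) / d ≤ Real.exp 10 * (Real.log Y / Real.log z) ^ 2 := by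
  have hlogz : 0 < Real.log z := Real.log_pos hz
  have hY1 : 1 < Y := by linarith
  have hlogY : 0 < Real.log Y := Real.log_pos hY1
  have hL1 : 1 ≤ Real.log Y / Real.log z := by
    rw [le_div_iff₀ hlogz, one_mul]; exact Real.log_le_log (by linarith) hzY
  have he : Real.exp 5 ^ 2 = Real.exp 10 := by rw [sq, ← Real.exp_add]; norm_num
  rcases le_or_gt 2 z with hz2 | hz2
  · refine (sum_rough_cardDivisors_div_le hz2 hzY).trans_eq ?_
    rw [mul_div_assoc, mul_pow, he]
  · -- `z < 2`: every `d` is `z`-rough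
    rcases lt_or_ge Y 2 with hY2 | hY2
    · -- only `d = 1`
      have hfl : ⌊Y⌋₊ = 1 := by
        rw [Nat.floor_eq_iff (by linarith)]; constructor <;> push_cast <;> linarith
      rw [hfl]
      have hset : (Ioc 0 1).filter (fun d : ℕ => d.Coprime (primesProdBelow z)) ⊆ {1} := by
        intro d hd
        rw [mem_filter, mem_Ioc] at hd
        rw [mem_singleton]; omega
      calc ∑ d ∈ (Ioc 0 1).filter (fun d : ℕ => d.Coprime (primesProdBelow z)), (#d.divisors : ℝ) / d
          ≤ ∑ d ∈ ({1} : Finset ℕ), (#d.divisors : ℝ) / d :=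
            sum_le_sum_of_subset_of_nonneg hset fun _ _ _ => by positivity
        _ = 1 := by simp
        _ ≤ Real.exp 10 * (Real.log Y / Real.log z) ^ 2 := by
            have h1 : (1 : ℝ) ≤ Real.exp 10 := Real.one_le_exp (by norm_num)
            nlinarith
    · have h2 := sum_rough_cardDivisors_div_le (le_refl (2 : ℝ)) hY2
      have hsub : (Ioc 0 ⌊Y⌋₊).filter (fun d : ℕ => d.Coprime (primesProdBelow z)) ⊆
          (Ioc 0 ⌊Y⌋₊).filter (fun d : ℕ => d.Coprime (primesProdBelow 2)) := by
        intro d hd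
        rw [mem_filter] at hd ⊢
        exact ⟨hd.1, coprime_primesProdBelow_of_le_two le_rfl d⟩
      have hlog2 : 0 < Real.log 2 := Real.log_pos one_lt_two
      have hratio : Real.log Y / Real.log 2 ≤ Real.log Y / Real.log z :=
        div_le_div_of_nonneg_left hlogY.le hlogz (Real.log_le_log (by linarith) hz2.le)
      calc _ ≤ ∑ d ∈ (Ioc 0 ⌊Y⌋₊).filter (fun d : ℕ => d.Coprime (primesProdBelow 2)),
              (#d.divisors : ℝ) / d :=
            sum_le_sum_of_subset_of_nonneg hsub fun _ _ _ => by positivity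
        _ ≤ (Real.exp 5 * Real.log Y / Real.log 2) ^ 2 := h2
        _ = Real.exp 10 * (Real.log Y / Real.log 2) ^ 2 := by rw [mul_div_assoc, mul_pow, he]
        _ ≤ Real.exp 10 * (Real.log Y / Real.log z) ^ 2 := by
            gcongr

/-! ### The non-squarefree rough numbers -/

/-- **The non-squarefree part**: for `1 < z ≤ Y`,
`∑_{z ≤ m ≤ Y, (m,P(z))=1, m not squarefree} τ(m)/m ≤ (6e^{10}/z)(log Y/log z)²`
("`≪ ∑_{p ≥ z} p⁻² ∑_{m ≤ Y/p², (m,P(z))=1} τ(m)/m ≪ z⁻¹(log Y/log z)²`": such an `m` is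
`p²m'` with `p ≥ z` prime, `τ(m) ≤ 3τ(m')`, `∑_{p ≥ z} p⁻² ≤ 2/z`).
[cite: MatomakiMerikoski2023, §4, proof of Lemma 2.2] -/
theorem sum_rough_not_squarefree_cardDivisors_div_le {z Y : ℝ} (hz : 1 < z) (hzY : z ≤ Y) :
    ∑ m ∈ ((Icc ⌈z⌉₊ ⌊Y⌋₊).filter (fun m : ℕ => m.Coprime (primesProdBelow z))).filter
        (fun m : ℕ => ¬ Squarefree m), (#m.divisors : ℝ) / m ≤
      6 * Real.exp 10 / z * (Real.log Y / Real.log z) ^ 2 := by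
  classical
  have hz0 : 0 < z := by linarith
  have hceil2 : 2 ≤ ⌈z⌉₊ := Nat.lt_ceil.mpr (by push_cast; linarith)
  set R := (Icc ⌈z⌉₊ ⌊Y⌋₊).filter (fun m : ℕ => m.Coprime (primesProdBelow z)) with hR
  set A := R.filter (fun m : ℕ => ¬ Squarefree m) with hA
  set Pr := (Nat.primesLE ⌊Y⌋₊).filter (fun p : ℕ => z ≤ (p : ℝ)) with hPr
  set T := ∑ d ∈ (Ioc 0 ⌊Y⌋₊).filter (fun d : ℕ => d.Coprime (primesProdBelow z)),
    (#d.divisors : ℝ) / d with hT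
  have hT0 : 0 ≤ T := sum_nonneg fun _ _ => by positivity
  have hTle : T ≤ Real.exp 10 * (Real.log Y / Real.log z) ^ 2 := sum_rough_cardDivisors_div_le' hz hzY
  set τd : ℕ → ℝ := fun m => (#m.divisors : ℝ) / m with hτd
  have hτd0 : ∀ m, 0 ≤ τd m := fun m => by positivity
  -- every non-squarefree rough `m` is divisible by `p²` for some prime `p ∈ Pr`
  have hcover : ∀ m ∈ A, ∃ p ∈ Pr, m ∈ R.filter (fun m : ℕ => p ^ 2 ∣ m) := by
    intro m hm
    rw [hA, mem_filter] at hm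
    obtain ⟨hmR, hsq⟩ := hm
    have hmR' := hmR
    rw [hR, mem_filter, mem_Icc] at hmR'
    obtain ⟨⟨hmz, hmY⟩, hcop⟩ := hmR'
    rw [Nat.squarefree_iff_prime_squarefree] at hsq
    push Not at hsq
    obtain ⟨p, hp', hpm⟩ := hsq
    have hpz : z ≤ (p : ℝ) := le_of_dvd_of_coprime_primesProdBelow hp' (dvd_trans (dvd_mul_right p p) hpm) hcop
    have hm0 : 0 < m := by omega
    have hpY : p ≤ ⌊Y⌋₊ := (Nat.le_of_dvd hm0 (dvd_trans (dvd_mul_right p p) hpm)).trans hmY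
    refine ⟨p, mem_primesGe.mpr ⟨hp', hpz, hpY⟩, mem_filter.mpr ⟨hmR, by rwa [sq]⟩⟩
  have hstep1 := sum_le_sum_sum_of_cover A Pr (fun p => R.filter (fun m : ℕ => p ^ 2 ∣ m)) τd hτd0 hcover
  -- the inner sums: `∑_{m ∈ R, p² ∣ m} τ(m)/m ≤ (3/p²) T`
  have hinner : ∀ p ∈ Pr, ∑ m ∈ R.filter (fun m : ℕ => p ^ 2 ∣ m), τd m ≤ 3 / (p : ℝ) ^ 2 * T := by
    intro p hp
    have hpp : p.Prime := (mem_primesGe.mp hp).1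
    have hp0 : 0 < p := hpp.pos
    have hp2 : 0 < p ^ 2 := pow_pos hp0 2
    have hp0' : (0 : ℝ) < p := by exact_mod_cast hp0
    set e : ℕ → ℕ := fun m => m / p ^ 2 with he
    have hinj : Set.InjOn e (R.filter (fun m : ℕ => p ^ 2 ∣ m) : Set ℕ) := by
      intro m₁ h₁ m₂ h₂ heq
      have d₁ : p ^ 2 ∣ m₁ := (mem_filter.mp h₁).2
      have d₂ : p ^ 2 ∣ m₂ := (mem_filter.mp h₂).2
      rw [← Nat.div_mul_cancel d₁, ← Nat.div_mul_cancel d₂]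
      exact congrArg (· * p ^ 2) heq
    have hpt : ∀ m ∈ R.filter (fun m : ℕ => p ^ 2 ∣ m), τd m ≤ 3 / (p : ℝ) ^ 2 * τd (e m) := by
      intro m hm
      obtain ⟨hmR, hdvd⟩ := mem_filter.mp hm
      rw [hR, mem_filter, mem_Icc] at hmR
      have hm0 : 0 < m := by omega
      have hem : p ^ 2 * e m = m := Nat.mul_div_cancel' hdvd
      have he0 : 0 < e m := Nat.div_pos (Nat.le_of_dvd hm0 hdvd) hp2
      have he0' : (0 : ℝ) < e m := by exact_mod_cast he0
      have hτ : (#m.divisors : ℝ) ≤ 3 * #(e m).divisors := by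
        have h1 := card_divisors_prime_sq_mul_le hpp (e m)
        rw [hem] at h1
        exact_mod_cast h1
      have hmcast : (m : ℝ) = (p : ℝ) ^ 2 * (e m : ℝ) := by exact_mod_cast hem.symm
      simp only [hτd]
      rw [hmcast, div_le_iff₀ (by positivity)]
      calc (#m.divisors : ℝ) ≤ 3 * #(e m).divisors := hτ
        _ = 3 / (p : ℝ) ^ 2 * ((#(e m).divisors : ℝ) / (e m : ℝ)) * ((p : ℝ) ^ 2 * (e m : ℝ)) := by
            field_simp
    have himg : (R.filter (fun m : ℕ => p ^ 2 ∣ m)).image e ⊆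
        (Ioc 0 ⌊Y⌋₊).filter (fun d : ℕ => d.Coprime (primesProdBelow z)) := by
      intro n hn
      obtain ⟨m, hm, rfl⟩ := mem_image.mp hn
      obtain ⟨hmR, hdvd⟩ := mem_filter.mp hm
      rw [hR, mem_filter, mem_Icc] at hmR
      have hm0 : 0 < m := by omega
      have he0 : 0 < e m := Nat.div_pos (Nat.le_of_dvd hm0 hdvd) hp2
      rw [mem_filter, mem_Ioc]
      refine ⟨⟨he0, (Nat.div_le_self m (p ^ 2)).trans hmR.1.2⟩, ?_⟩
      exact Nat.Coprime.coprime_dvd_left (Nat.div_dvd_of_dvd hdvd) hmR.2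
    calc ∑ m ∈ R.filter (fun m : ℕ => p ^ 2 ∣ m), τd m
        ≤ ∑ m ∈ R.filter (fun m : ℕ => p ^ 2 ∣ m), 3 / (p : ℝ) ^ 2 * τd (e m) := sum_le_sum hpt
      _ = ∑ n ∈ (R.filter (fun m : ℕ => p ^ 2 ∣ m)).image e, 3 / (p : ℝ) ^ 2 * τd n := by
          rw [sum_image hinj]
      _ ≤ ∑ n ∈ (Ioc 0 ⌊Y⌋₊).filter (fun d : ℕ => d.Coprime (primesProdBelow z)), 3 / (p : ℝ) ^ 2 * τd n :=
          sum_le_sum_of_subset_of_nonneg himg fun n _ _ => by positivity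
      _ = 3 / (p : ℝ) ^ 2 * T := by rw [hT, mul_sum]
  -- `∑_{p ∈ Pr} 1/p² ≤ 2/z`
  have hPr_sq : ∑ p ∈ Pr, ((p : ℝ) ^ 2)⁻¹ ≤ 2 / z := by
    have hsub : Pr ⊆ Ioo (⌈z⌉₊ - 1) (⌊Y⌋₊ + 1) := by
      intro p hp
      obtain ⟨hpp, hpz, hpY⟩ := mem_primesGe.mp hp
      rw [mem_Ioo]
      have h1 : ⌈z⌉₊ ≤ p := Nat.ceil_le.mpr hpz
      omega
    calc ∑ p ∈ Pr, ((p : ℝ) ^ 2)⁻¹ ≤ ∑ p ∈ Ioo (⌈z⌉₊ - 1) (⌊Y⌋₊ + 1), ((p : ℝ) ^ 2)⁻¹ :=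
          sum_le_sum_of_subset_of_nonneg hsub fun _ _ _ => by positivity
      _ ≤ 2 / ((⌈z⌉₊ - 1 : ℕ) + 1) := sum_Ioo_inv_sq_le _ _
      _ = 2 / (⌈z⌉₊ : ℝ) := by
          congr 1
          have : 1 ≤ ⌈z⌉₊ := by omega
          exact_mod_cast Nat.sub_add_cancel this
      _ ≤ 2 / z := div_le_div_of_nonneg_left (by norm_num) hz0 (Nat.le_ceil z)
  calc ∑ m ∈ A, τd m ≤ ∑ p ∈ Pr, ∑ m ∈ R.filter (fun m : ℕ => p ^ 2 ∣ m), τd m := hstep1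
    _ ≤ ∑ p ∈ Pr, 3 / (p : ℝ) ^ 2 * T := sum_le_sum hinner
    _ = 3 * T * ∑ p ∈ Pr, ((p : ℝ) ^ 2)⁻¹ := by
        rw [mul_sum]; exact sum_congr rfl fun p _ => by ring
    _ ≤ 3 * (Real.exp 10 * (Real.log Y / Real.log z) ^ 2) * (2 / z) := by
        gcongr
    _ = 6 * Real.exp 10 / z * (Real.log Y / Real.log z) ^ 2 := by ring

/-! ### The prime sum `∑_{z ≤ p ≤ Y} λ(p)/p` -/

/-- **`∑_{z ≤ p ≤ Y} λ(p)/p ≪ 1/(v²η^{v/2}) + (v/η)(log Y/log z)`** for `z = q^v`, `v > 0`,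
`Y > z`, with an absolute constant: cover the primes of `[z, Y]` by the ranges
`(q^{c/k}, q^{c/(k−1)}]`, `2 ≤ k ≤ K`, and `(q^c, Y]` of Lemma 4.1 (`c = 1/2 + δ`, `δ = 1/4`,
`K = ⌊c/v⌋ + 1`, so that `q^{c/K} < z`; if `K ≥ 2` then `K ≤ 2c/v` and `η^{−1/K} ≤ η^{−v/2}`):
"`∑_{z ≤ p ≤ Y} λ(p)/p ≪_δ K²η^{−1/K} + log Y/(η log q) ≪ 1/(v²η^{v/2}) + (v/η)(log Y/log z)`".
[cite: MatomakiMerikoski2023, §4, proof of Lemma 2.2] -/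
theorem sum_primesGe_charDivisorSum_div_le :
    ∃ C : ℝ, 0 < C ∧ ∀ (q : ℕ) [NeZero q] (χ : DirichletCharacter ℂ q), χ.IsPrimitive →
      χ.IsQuadratic → ∀ η : ℝ, 10 ≤ η → χ.LFunction ((1 - 1 / (η * Real.log q) : ℝ) : ℂ) = 0 →
      ∀ v : ℝ, 0 < v → ∀ Y : ℝ, (q : ℝ) ^ v < Y →
        ∑ p ∈ (Nat.primesLE ⌊Y⌋₊).filter (fun p : ℕ => (q : ℝ) ^ v ≤ p),
            charDivisorSum χ p / p ≤
          C * (1 / (v ^ 2 * η ^ (v / 2)) + v / η * (Real.log Y / Real.log ((q : ℝ) ^ v))) := by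
  obtain ⟨K₁, hK₁, H₁⟩ := MatomakiMerikoski2023_lemma41_first (δ := 1 / 4) (by norm_num)
  obtain ⟨K₂, hK₂, H₂⟩ := MatomakiMerikoski2023_lemma41_second (δ := 1 / 4) (by norm_num)
  refine ⟨K₁ + 4 * K₂, by positivity, ?_⟩
  intro q _ χ hprim hquad η hη hL v hv Y hY
  classical
  have hq2 : (2 : ℝ) ≤ q := by exact_mod_cast two_le_of_LFunction_eq_zero hL
  have hq0 : (0 : ℝ) < q := by linarith
  have hq1 : (1 : ℝ) < q := by linarith
  have hlogq : 0 < Real.log q := Real.log_pos hq1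
  have hη0 : 0 < η := by linarith
  have hη1 : 1 ≤ η := by linarith
  have hsq : χ ^ 2 = 1 := MulChar.isQuadratic_iff_sq_eq_one.mp hquad
  set c : ℝ := 1 / 2 + 1 / 4 with hc_def
  have hc0 : 0 < c := by rw [hc_def]; norm_num
  have hc34 : c = 3 / 4 := by rw [hc_def]; norm_num
  set z : ℝ := (q : ℝ) ^ v with hz_def
  have hz1 : 1 < z := Real.one_lt_rpow hq1 hv
  have hz0 : 0 < z := by linarith
  have hlogz : Real.log z = v * Real.log q := Real.log_rpow hq0 v
  have hlogz0 : 0 < Real.log z := Real.log_pos hz1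
  have hY1 : 1 < Y := hz1.trans hY
  have hlogY : 0 < Real.log Y := Real.log_pos hY1
  set L : ℝ := Real.log Y / Real.log z with hL_def
  have hL1 : 1 < L := by rw [hL_def, one_lt_div hlogz0]; exact Real.log_lt_log hz0 hY
  have hL0 : 0 < L := by linarith
  set g : ℕ → ℝ := fun p => charDivisorSum χ p / p with hg_def
  have hg0 : ∀ p, 0 ≤ g p := fun p =>
    div_nonneg (charDivisorSum_nonneg χ hsq p) (Nat.cast_nonneg p)
  set K : ℕ := ⌊c / v⌋₊ + 1 with hK_def
  -- the ranges of Lemma 4.1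
  set r : ℕ → Finset ℕ := fun k => if k = 1 then (Ioc ⌊(q : ℝ) ^ c⌋₊ ⌊Y⌋₊).filter Nat.Prime
    else (Ioc ⌊(q : ℝ) ^ (c / k)⌋₊ ⌊(q : ℝ) ^ (c / ((k : ℝ) - 1))⌋₊).filter Nat.Prime with hr_def
  set Pr := (Nat.primesLE ⌊Y⌋₊).filter (fun p : ℕ => z ≤ (p : ℝ)) with hPr_def
  have hcover : ∀ p ∈ Pr, ∃ k ∈ Icc 1 K, p ∈ r k := by
    intro p hp
    obtain ⟨hpp, hpz, hpY⟩ := mem_primesGe.mp hp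
    have hp0 : (0 : ℝ) < p := by exact_mod_cast hpp.pos
    have hlogp : Real.log z ≤ Real.log p := Real.log_le_log hz0 hpz
    have hlogp0 : 0 < Real.log p := hlogz0.trans_le hlogp
    set t : ℝ := c * Real.log q / Real.log p with ht_def
    have ht0 : 0 ≤ t := by positivity
    set k : ℕ := ⌊t⌋₊ + 1 with hk_def
    have hkpos : 0 < k := Nat.succ_pos _
    have htk : t < k := by rw [hk_def]; push_cast; exact Nat.lt_floor_add_one t
    have hkt : (k : ℝ) - 1 ≤ t := by rw [hk_def]; push_cast; linarith [Nat.floor_le ht0]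
    -- `k ≤ K` because `t ≤ c/v` (i.e. `log z ≤ log p`)
    have htcv : t ≤ c / v := by
      rw [ht_def, div_le_div_iff₀ hlogp0 hv]
      calc c * Real.log q * v = c * Real.log z := by rw [hlogz]; ring
        _ ≤ c * Real.log p := mul_le_mul_of_nonneg_left hlogp hc0.le
    have hkK : k ≤ K := Nat.succ_le_succ (Nat.floor_mono htcv)
    refine ⟨k, mem_Icc.mpr ⟨hkpos, hkK⟩, ?_⟩
    have hk0 : (0 : ℝ) < k := by exact_mod_cast hkpos
    -- `q^{c/k} < p`
    have hlow : (q : ℝ) ^ (c / k) < p := by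
      rw [← Real.log_lt_log_iff (Real.rpow_pos_of_pos hq0 _) hp0, Real.log_rpow hq0]
      have h1 := htk
      rw [ht_def, div_lt_iff₀ hlogp0] at h1
      rw [div_mul_eq_mul_div, div_lt_iff₀ hk0]
      linarith
    by_cases hk1 : k = 1
    · have hr1 : r k = (Ioc ⌊(q : ℝ) ^ c⌋₊ ⌊Y⌋₊).filter Nat.Prime := by simp [hr_def, hk1]
      rw [hr1, mem_filter, mem_Ioc]
      refine ⟨⟨?_, hpY⟩, hpp⟩
      rw [hk1, Nat.cast_one, div_one] at hlow
      exact (Nat.floor_lt (Real.rpow_nonneg hq0.le _)).mpr hlow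
    · have hr2 : r k = (Ioc ⌊(q : ℝ) ^ (c / k)⌋₊ ⌊(q : ℝ) ^ (c / ((k : ℝ) - 1))⌋₊).filter
          Nat.Prime := by simp [hr_def, hk1]
      rw [hr2, mem_filter, mem_Ioc]
      refine ⟨⟨(Nat.floor_lt (Real.rpow_nonneg hq0.le _)).mpr hlow, ?_⟩, hpp⟩
      have hk2 : (0 : ℝ) < (k : ℝ) - 1 := by
        have h2 : (2 : ℝ) ≤ k := by exact_mod_cast (show 2 ≤ k by omega)
        linarith
      refine Nat.le_floor ?_
      rw [← Real.log_le_log_iff hp0 (Real.rpow_pos_of_pos hq0 _), Real.log_rpow hq0]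
      rw [div_mul_eq_mul_div, le_div_iff₀ hk2]
      have h1 := hkt
      rw [ht_def, le_div_iff₀ hlogp0] at h1
      linarith
  have hstep := sum_le_sum_sum_of_cover Pr (Icc 1 K) r g hg0 hcover
  -- split off `k = 1`
  have hsplit : ∑ k ∈ Icc 1 K, ∑ p ∈ r k, g p =
      ∑ p ∈ r 1, g p + ∑ k ∈ Icc 2 K, ∑ p ∈ r k, g p := by
    have h1 : Icc 1 K = insert 1 (Icc 2 K) := by
      ext k; simp only [mem_insert, mem_Icc]; omega
    rw [h1, sum_insert (by simp)]
  -- the range `(q^c, Y]`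
  have hpart1 : ∑ p ∈ r 1, g p ≤ K₁ * (v / η * L) := by
    have hr1 : r 1 = (Ioc ⌊(q : ℝ) ^ c⌋₊ ⌊Y⌋₊).filter Nat.Prime := by simp [hr_def]
    rw [hr1]
    rcases le_or_gt Y ((q : ℝ) ^ c) with hYc | hYc
    · have hempty : Ioc ⌊(q : ℝ) ^ c⌋₊ ⌊Y⌋₊ = ∅ :=
        Finset.Ioc_eq_empty (not_lt.mpr (Nat.floor_mono hYc))
      rw [hempty, filter_empty, sum_empty]
      positivity
    · have h := H₁ q χ hprim hquad η hη hL Y hYc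
      calc ∑ p ∈ (Ioc ⌊(q : ℝ) ^ c⌋₊ ⌊Y⌋₊).filter Nat.Prime, g p
          ≤ K₁ * Real.log Y / (η * Real.log q) := h
        _ = K₁ * (v / η * L) := by rw [hL_def, hlogz]; field_simp
  -- the ranges `(q^{c/k}, q^{c/(k-1)}]`, `2 ≤ k ≤ K`
  have hpart2 : ∑ k ∈ Icc 2 K, ∑ p ∈ r k, g p ≤ 4 * K₂ * (1 / (v ^ 2 * η ^ (v / 2))) := by
    rcases Nat.lt_or_ge K 2 with hK2 | hK2
    · have h1 : Icc 2 K = ∅ := Finset.Icc_eq_empty (by omega)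
      rw [h1, sum_empty]
      positivity
    · have hKpos : (0 : ℝ) < K := by exact_mod_cast (show 0 < K by omega)
      have hηK : 0 < η ^ ((1 : ℝ) / K) := Real.rpow_pos_of_pos hη0 _
      have hterm : ∀ k ∈ Icc 2 K, ∑ p ∈ r k, g p ≤ K₂ * K / η ^ ((1 : ℝ) / K) := by
        intro k hk
        obtain ⟨hk2, hkK⟩ := mem_Icc.mp hk
        have hk1 : k ≠ 1 := by omega
        have hrk : r k = (Ioc ⌊(q : ℝ) ^ (c / k)⌋₊ ⌊(q : ℝ) ^ (c / ((k : ℝ) - 1))⌋₊).filter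
            Nat.Prime := by simp [hr_def, hk1]
        rw [hrk]
        refine (H₂ q χ hprim hquad η hη hL k hk2).trans ?_
        have hk0 : (0 : ℝ) < k := by exact_mod_cast (show 0 < k by omega)
        have hkK' : (k : ℝ) ≤ K := by exact_mod_cast hkK
        have hpow : η ^ ((1 : ℝ) / K) ≤ η ^ ((1 : ℝ) / k) :=
          Real.rpow_le_rpow_of_exponent_le hη1 (div_le_div_of_nonneg_left zero_le_one hk0 hkK')
        rw [mul_div_assoc, mul_div_assoc]
        exact mul_le_mul_of_nonneg_left (div_le_div₀ hKpos.le hkK' hηK hpow) hK₂.le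
      -- `K ≤ 2c/v = (3/2)/v`, so `K² ≤ 4/v²` and `η^{-1/K} ≤ η^{-v/2}`
      have hfl : (1 : ℝ) ≤ ⌊c / v⌋₊ := by exact_mod_cast (show 1 ≤ ⌊c / v⌋₊ by omega)
      have hfl' : (⌊c / v⌋₊ : ℝ) ≤ c / v := Nat.floor_le (by positivity)
      have hKle : (K : ℝ) ≤ 2 * (c / v) := by rw [hK_def]; push_cast; linarith
      have hKv : (K : ℝ) * v ≤ 3 / 2 := by
        have h1 := mul_le_mul_of_nonneg_right hKle hv.le
        rw [mul_assoc, div_mul_cancel₀ _ hv.ne', hc34] at h1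
        linarith
      have hexp : v / 2 ≤ (1 : ℝ) / K := by
        rw [div_le_div_iff₀ two_pos hKpos]
        linarith
      have hηpow : η ^ (v / 2) ≤ η ^ ((1 : ℝ) / K) := Real.rpow_le_rpow_of_exponent_le hη1 hexp
      have hηv : 0 < η ^ (v / 2) := Real.rpow_pos_of_pos hη0 _
      have hK2v : (K : ℝ) ^ 2 ≤ 4 / v ^ 2 := by
        have h1 : (K : ℝ) ≤ 2 / v := by
          rw [le_div_iff₀ hv]; linarith
        calc (K : ℝ) ^ 2 ≤ (2 / v) ^ 2 := pow_le_pow_left₀ hKpos.le h1 2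
          _ = 4 / v ^ 2 := by ring
      calc ∑ k ∈ Icc 2 K, ∑ p ∈ r k, g p
          ≤ ∑ k ∈ Icc 2 K, K₂ * K / η ^ ((1 : ℝ) / K) := sum_le_sum hterm
        _ = ((K + 1 - 2 : ℕ) : ℝ) * (K₂ * K / η ^ ((1 : ℝ) / K)) := by
            rw [sum_const, Nat.card_Icc, nsmul_eq_mul]
        _ ≤ (K : ℝ) * (K₂ * K / η ^ ((1 : ℝ) / K)) := by
            refine mul_le_mul_of_nonneg_right ?_ (by positivity)
            exact_mod_cast (show K + 1 - 2 ≤ K by omega)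
        _ = K₂ * ((K : ℝ) ^ 2 / η ^ ((1 : ℝ) / K)) := by ring
        _ ≤ K₂ * ((4 / v ^ 2) / η ^ (v / 2)) :=
            mul_le_mul_of_nonneg_left (div_le_div₀ (by positivity) hK2v hηv hηpow) hK₂.le
        _ = 4 * K₂ * (1 / (v ^ 2 * η ^ (v / 2))) := by
            field_simp
  -- assemble
  have hB1 : 0 ≤ 1 / (v ^ 2 * η ^ (v / 2)) := by positivity
  have hB2 : 0 ≤ v / η * L := by positivity
  calc ∑ p ∈ Pr, g p ≤ ∑ k ∈ Icc 1 K, ∑ p ∈ r k, g p := hstep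
    _ = ∑ p ∈ r 1, g p + ∑ k ∈ Icc 2 K, ∑ p ∈ r k, g p := hsplit
    _ ≤ K₁ * (v / η * L) + 4 * K₂ * (1 / (v ^ 2 * η ^ (v / 2))) := add_le_add hpart1 hpart2
    _ ≤ (K₁ + 4 * K₂) * (1 / (v ^ 2 * η ^ (v / 2)) + v / η * L) := by
        nlinarith [mul_nonneg hK₁.le hB1, mul_nonneg hK₂.le hB2]

/-! ### Lemma 2.2 -/

/-- **Matomäki–Merikoski 2023, Lemma 2.2** ("Let `χ` be a primitive quadratic character modulo
`q ≥ 2`. Assume that `L(s, χ)` has a real zero `β₀` such that `β₀ = 1 − 1/(η log q)` for some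
`η ≥ 10`. Let `z = q^v` for some `v ∈ ℝ₊`. Then for any `Y > z`
`∑_{z ≤ m ≤ Y, (m, P(z)) = 1} λ(m)/m ≪ (1/(v²η^{v/2}) + (v/η)·(log Y/log z) + 1/z)(log Y/log z)²`"),
`λ = 1 ∗ χ = RealChar.charDivisorSum χ`, `P(z) = ∏_{p<z} p`, with an absolute implied constant,
PROVED as in §4 of the source: if the bracket is `> 1` the claim is the trivial bound
`λ ≤ τ` with `sum_rough_cardDivisors_div_le'`; otherwise the squarefree `m` contribute
`≤ ∏_{z ≤ p ≤ Y}(1 + λ(p)/p) − 1 ≤ exp(∑_{z ≤ p ≤ Y} λ(p)/p) − 1 ≪ 1/(v²η^{v/2}) + (v/η)(log Y/log z)`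
(`sum_squarefree_le_prod_one_add_sub_one`, `sum_primesGe_charDivisorSum_div_le`), and the
non-squarefree `m` contribute `≪ z⁻¹(log Y/log z)²`
(`sum_rough_not_squarefree_cardDivisors_div_le`). [cite: MatomakiMerikoski2023, Lemma 2.2] -/
theorem MatomakiMerikoski2023_lemma22 :
    ∃ K : ℝ, 0 < K ∧ ∀ (q : ℕ) [NeZero q] (χ : DirichletCharacter ℂ q), χ.IsPrimitive →
      χ.IsQuadratic → ∀ η : ℝ, 10 ≤ η → χ.LFunction ((1 - 1 / (η * Real.log q) : ℝ) : ℂ) = 0 →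
      ∀ v : ℝ, 0 < v → ∀ Y : ℝ, (q : ℝ) ^ v < Y →
        ∑ m ∈ (Icc ⌈(q : ℝ) ^ v⌉₊ ⌊Y⌋₊).filter
            (fun m : ℕ => m.Coprime (primesProdBelow ((q : ℝ) ^ v))), charDivisorSum χ m / m ≤
          K * (1 / (v ^ 2 * η ^ (v / 2)) + v / η * (Real.log Y / Real.log ((q : ℝ) ^ v))
            + 1 / (q : ℝ) ^ v) * (Real.log Y / Real.log ((q : ℝ) ^ v)) ^ 2 := by
  obtain ⟨C, hC, HC⟩ := sum_primesGe_charDivisorSum_div_le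
  refine ⟨C * Real.exp C + 6 * Real.exp 10 + Real.exp 10, by positivity, ?_⟩
  intro q _ χ hprim hquad η hη hL v hv Y hY
  classical
  have hq2 : (2 : ℝ) ≤ q := by exact_mod_cast two_le_of_LFunction_eq_zero hL
  have hq1 : (1 : ℝ) < q := by linarith
  have hη0 : 0 < η := by linarith
  have hsq : χ ^ 2 = 1 := MulChar.isQuadratic_iff_sq_eq_one.mp hquad
  have hSP := HC q χ hprim hquad η hη hL v hv Y hY
  set z : ℝ := (q : ℝ) ^ v with hz_def
  have hz1 : 1 < z := Real.one_lt_rpow hq1 hv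
  have hz0 : 0 < z := by linarith
  have hlogz0 : 0 < Real.log z := Real.log_pos hz1
  set L : ℝ := Real.log Y / Real.log z with hL_def
  have hL1 : 1 < L := by rw [hL_def, one_lt_div hlogz0]; exact Real.log_lt_log hz0 hY
  have hL0 : 0 < L := by linarith
  have hLsq : 1 ≤ L ^ 2 := by nlinarith
  set B' : ℝ := 1 / (v ^ 2 * η ^ (v / 2)) + v / η * L with hB'_def
  have hB'0 : 0 ≤ B' := by positivity
  have hz' : 0 < 1 / z := by positivity
  set B : ℝ := B' + 1 / z with hB_def
  have hzB : 1 / z ≤ B := by rw [hB_def]; linarith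
  have hB'B : B' ≤ B := by rw [hB_def]; linarith
  have hB0 : 0 < B := by linarith
  set R := (Icc ⌈z⌉₊ ⌊Y⌋₊).filter (fun m : ℕ => m.Coprime (primesProdBelow z)) with hR_def
  set g : ℕ → ℝ := fun m => charDivisorSum χ m / m with hg_def
  have hg0 : ∀ m, 0 ≤ g m := fun m =>
    div_nonneg (charDivisorSum_nonneg χ hsq m) (Nat.cast_nonneg m)
  have hgτ : ∀ m, g m ≤ (#m.divisors : ℝ) / m := fun m =>
    div_le_div_of_nonneg_right ((le_abs_self _).trans (abs_charDivisorSum_le χ m)) (Nat.cast_nonneg m)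
  have hceil2 : 2 ≤ ⌈z⌉₊ := Nat.lt_ceil.mpr (by push_cast; linarith)
  -- the trivial bound `∑_R λ(m)/m ≤ e^{10} L²`
  have htriv : ∑ m ∈ R, g m ≤ Real.exp 10 * L ^ 2 := by
    have hsub : R ⊆ (Ioc 0 ⌊Y⌋₊).filter (fun d : ℕ => d.Coprime (primesProdBelow z)) := by
      intro m hm
      rw [hR_def, mem_filter, mem_Icc] at hm
      rw [mem_filter, mem_Ioc]
      exact ⟨⟨by omega, hm.1.2⟩, hm.2⟩
    calc ∑ m ∈ R, g m ≤ ∑ m ∈ R, (#m.divisors : ℝ) / m := sum_le_sum fun m _ => hgτ m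
      _ ≤ ∑ m ∈ (Ioc 0 ⌊Y⌋₊).filter (fun d : ℕ => d.Coprime (primesProdBelow z)),
            (#m.divisors : ℝ) / m :=
          sum_le_sum_of_subset_of_nonneg hsub fun _ _ _ => by positivity
      _ ≤ Real.exp 10 * L ^ 2 := sum_rough_cardDivisors_div_le' hz1 hY.le
  by_cases hB1 : B ≤ 1
  · -- split into squarefree and non-squarefree `m`
    have hsplit : ∑ m ∈ R, g m =
        ∑ m ∈ R.filter Squarefree, g m + ∑ m ∈ R.filter (fun m => ¬ Squarefree m), g m :=
      (sum_filter_add_sum_filter_not R Squarefree g).symm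
    set Pr := (Nat.primesLE ⌊Y⌋₊).filter (fun p : ℕ => z ≤ (p : ℝ)) with hPr_def
    -- `λ(m)/m` as a multiplicative arithmetic function
    set f : ArithmeticFunction ℝ :=
      (charDivisorSum χ).pdiv (ArithmeticFunction.id : ArithmeticFunction ℝ) with hf_def
    have hf_apply : ∀ m, f m = g m := by
      intro m
      rw [hf_def, ArithmeticFunction.pdiv_apply, ArithmeticFunction.natCoe_apply,
        ArithmeticFunction.id_apply]
    have hf_mult : f.IsMultiplicative :=
      (isMultiplicative_charDivisorSum χ hsq).pdiv ArithmeticFunction.isMultiplicative_id.natCast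
    have hS : ∀ m ∈ R.filter Squarefree, Squarefree m ∧ m ≠ 1 ∧ m.primeFactors ⊆ Pr := by
      intro m hm
      obtain ⟨hmR, hsqf⟩ := mem_filter.mp hm
      rw [hR_def, mem_filter, mem_Icc] at hmR
      refine ⟨hsqf, by omega, fun p hp => ?_⟩
      have hpp := Nat.prime_of_mem_primeFactors hp
      have hpm := Nat.dvd_of_mem_primeFactors hp
      have hm0 : 0 < m := by omega
      exact mem_primesGe.mpr ⟨hpp, le_of_dvd_of_coprime_primesProdBelow hpp hpm hmR.2,
        (Nat.le_of_dvd hm0 hpm).trans hmR.1.2⟩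
    have hS0 : 0 ≤ ∑ p ∈ Pr, g p := sum_nonneg fun p _ => hg0 p
    have hsf : ∑ m ∈ R.filter Squarefree, g m ≤ C * Real.exp C * B' := by
      calc ∑ m ∈ R.filter Squarefree, g m = ∑ m ∈ R.filter Squarefree, f m :=
            sum_congr rfl fun m _ => (hf_apply m).symm
        _ ≤ ∏ p ∈ Pr, (1 + f p) - 1 :=
            sum_squarefree_le_prod_one_add_sub_one hf_mult
              (fun p _ => by rw [hf_apply]; exact hg0 p) hS
        _ = ∏ p ∈ Pr, (1 + g p) - 1 := by simp only [hf_apply]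
        _ ≤ Real.exp (∑ p ∈ Pr, g p) - 1 := by
            linarith [prod_one_add_le_exp_sum (P := Pr) (f := g) (fun p _ => hg0 p)]
        _ ≤ (∑ p ∈ Pr, g p) * Real.exp (∑ p ∈ Pr, g p) := by
            -- `e^x − 1 ≤ x e^x` (from `1 − x ≤ e^{−x}`)
            have h1 := Real.add_one_le_exp (-∑ p ∈ Pr, g p)
            have h2 : Real.exp (-∑ p ∈ Pr, g p) * Real.exp (∑ p ∈ Pr, g p) = 1 := by
              rw [← Real.exp_add]; simp
            nlinarith [Real.exp_pos (∑ p ∈ Pr, g p), Real.exp_pos (-∑ p ∈ Pr, g p)]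
        _ ≤ (C * B') * Real.exp C := by
            have hCB : C * B' ≤ C := by
              have := mul_le_mul_of_nonneg_left (hB'B.trans hB1) hC.le
              linarith
            exact mul_le_mul hSP (Real.exp_le_exp.mpr (hSP.trans hCB)) (Real.exp_pos _).le
              (by positivity)
        _ = C * Real.exp C * B' := by ring
    have hnsf : ∑ m ∈ R.filter (fun m => ¬ Squarefree m), g m ≤ 6 * Real.exp 10 / z * L ^ 2 :=
      (sum_le_sum fun m _ => hgτ m).trans (sum_rough_not_squarefree_cardDivisors_div_le hz1 hY.le)
    have h1 : C * Real.exp C * B' ≤ C * Real.exp C * B * L ^ 2 := by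
      have h3 : 0 ≤ C * Real.exp C := by positivity
      calc C * Real.exp C * B' ≤ C * Real.exp C * B := mul_le_mul_of_nonneg_left hB'B h3
        _ = C * Real.exp C * B * 1 := by ring
        _ ≤ C * Real.exp C * B * L ^ 2 := mul_le_mul_of_nonneg_left hLsq (by positivity)
    have h2 : 6 * Real.exp 10 / z * L ^ 2 ≤ 6 * Real.exp 10 * B * L ^ 2 := by
      have h3 : 6 * Real.exp 10 / z = 6 * Real.exp 10 * (1 / z) := by ring
      rw [h3]
      exact mul_le_mul_of_nonneg_right (mul_le_mul_of_nonneg_left hzB (by positivity)) (by positivity)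
    have h4 : 0 ≤ Real.exp 10 * B * L ^ 2 := by positivity
    calc ∑ m ∈ R, g m = _ := hsplit
      _ ≤ C * Real.exp C * B' + 6 * Real.exp 10 / z * L ^ 2 := add_le_add hsf hnsf
      _ ≤ C * Real.exp C * B * L ^ 2 + 6 * Real.exp 10 * B * L ^ 2 := add_le_add h1 h2
      _ ≤ (C * Real.exp C + 6 * Real.exp 10 + Real.exp 10) * B * L ^ 2 := by nlinarith
  · push Not at hB1
    have h1 : 0 ≤ Real.exp 10 * L ^ 2 * (B - 1) :=
      mul_nonneg (by positivity) (by linarith)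
    have h2 : 0 ≤ (C * Real.exp C + 6 * Real.exp 10) * B * L ^ 2 := by positivity
    calc ∑ m ∈ R, g m ≤ Real.exp 10 * L ^ 2 := htriv
      _ ≤ (C * Real.exp C + 6 * Real.exp 10 + Real.exp 10) * B * L ^ 2 := by nlinarith

/-- **Matomäki–Merikoski 2023, Lemma 2.2, sharp form** (what the printed proof actually gives, §4 of the
source, last display: "`∑_{z ≤ m ≤ Y, (m,P(z))=1} |μ(m)|λ(m)/m ≤ exp(∑_{z ≤ p ≤ Y} λ(p)/p) − 1 ≪ 1/(v²η^{v/2}) + (v/η)(log Y/log z)`"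
under the normalisation (4.5), plus "`≪ z⁻¹ (log Y/log z)²`" for the non-squarefree `m`): with
`B' = 1/(v²η^{v/2}) + (v/η)(log Y/log z)` and `L = log Y/log z`, IF `B' + 1/z ≤ 1` then
`∑_{z ≤ m ≤ Y, (m, P(z)) = 1} λ(m)/m ≤ K (B' + L²/z)` —
i.e. the factor `(log Y/log z)²` of the printed statement multiplies only the `1/z` term.  (The printed
Lemma 2.2 multiplies the whole bracket by `L²` so as to cover also the range where (4.5) fails, where it is
the trivial bound; in the application in §7 of the source this sharper form saves two powers of
`u = log X/log z` in the term `u⁶V/η`.)  Same proof as `MatomakiMerikoski2023_lemma22`.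
[cite: MatomakiMerikoski2023, Lemma 2.2 and §4 (proof)] -/
theorem MatomakiMerikoski2023_lemma22_sharp :
    ∃ K : ℝ, 0 < K ∧ ∀ (q : ℕ) [NeZero q] (χ : DirichletCharacter ℂ q), χ.IsPrimitive →
      χ.IsQuadratic → ∀ η : ℝ, 10 ≤ η → χ.LFunction ((1 - 1 / (η * Real.log q) : ℝ) : ℂ) = 0 →
      ∀ v : ℝ, 0 < v → ∀ Y : ℝ, (q : ℝ) ^ v < Y →
        1 / (v ^ 2 * η ^ (v / 2)) + v / η * (Real.log Y / Real.log ((q : ℝ) ^ v)) + 1 / (q : ℝ) ^ v ≤ 1 →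
        ∑ m ∈ (Icc ⌈(q : ℝ) ^ v⌉₊ ⌊Y⌋₊).filter
            (fun m : ℕ => m.Coprime (primesProdBelow ((q : ℝ) ^ v))), charDivisorSum χ m / m ≤
          K * ((1 / (v ^ 2 * η ^ (v / 2)) + v / η * (Real.log Y / Real.log ((q : ℝ) ^ v)))
            + 1 / (q : ℝ) ^ v * (Real.log Y / Real.log ((q : ℝ) ^ v)) ^ 2) := by
  obtain ⟨C, hC, HC⟩ := sum_primesGe_charDivisorSum_div_le
  refine ⟨C * Real.exp C + 6 * Real.exp 10, by positivity, ?_⟩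
  intro q _ χ hprim hquad η hη hL v hv Y hY hB1
  classical
  have hq2 : (2 : ℝ) ≤ q := by exact_mod_cast two_le_of_LFunction_eq_zero hL
  have hq1 : (1 : ℝ) < q := by linarith
  have hη0 : 0 < η := by linarith
  have hsq : χ ^ 2 = 1 := MulChar.isQuadratic_iff_sq_eq_one.mp hquad
  have hSP := HC q χ hprim hquad η hη hL v hv Y hY
  set z : ℝ := (q : ℝ) ^ v with hz_def
  have hz1 : 1 < z := Real.one_lt_rpow hq1 hv
  have hz0 : 0 < z := by linarith
  have hlogz0 : 0 < Real.log z := Real.log_pos hz1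
  set L : ℝ := Real.log Y / Real.log z with hL_def
  have hL1 : 1 < L := by rw [hL_def, one_lt_div hlogz0]; exact Real.log_lt_log hz0 hY
  have hL0 : 0 < L := by linarith
  set B' : ℝ := 1 / (v ^ 2 * η ^ (v / 2)) + v / η * L with hB'_def
  have hB'0 : 0 ≤ B' := by positivity
  have hz' : 0 < 1 / z := by positivity
  have hB'1 : B' ≤ 1 := by linarith
  set R := (Icc ⌈z⌉₊ ⌊Y⌋₊).filter (fun m : ℕ => m.Coprime (primesProdBelow z)) with hR_def
  set g : ℕ → ℝ := fun m => charDivisorSum χ m / m with hg_def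
  have hg0 : ∀ m, 0 ≤ g m := fun m =>
    div_nonneg (charDivisorSum_nonneg χ hsq m) (Nat.cast_nonneg m)
  have hgτ : ∀ m, g m ≤ (#m.divisors : ℝ) / m := fun m =>
    div_le_div_of_nonneg_right ((le_abs_self _).trans (abs_charDivisorSum_le χ m)) (Nat.cast_nonneg m)
  -- split into squarefree and non-squarefree `m`
  have hsplit : ∑ m ∈ R, g m =
      ∑ m ∈ R.filter Squarefree, g m + ∑ m ∈ R.filter (fun m => ¬ Squarefree m), g m :=
    (sum_filter_add_sum_filter_not R Squarefree g).symm
  set Pr := (Nat.primesLE ⌊Y⌋₊).filter (fun p : ℕ => z ≤ (p : ℝ)) with hPr_def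
  set f : ArithmeticFunction ℝ :=
    (charDivisorSum χ).pdiv (ArithmeticFunction.id : ArithmeticFunction ℝ) with hf_def
  have hf_apply : ∀ m, f m = g m := by
    intro m
    rw [hf_def, ArithmeticFunction.pdiv_apply, ArithmeticFunction.natCoe_apply,
      ArithmeticFunction.id_apply]
  have hf_mult : f.IsMultiplicative :=
    (isMultiplicative_charDivisorSum χ hsq).pdiv ArithmeticFunction.isMultiplicative_id.natCast
  have hS : ∀ m ∈ R.filter Squarefree, Squarefree m ∧ m ≠ 1 ∧ m.primeFactors ⊆ Pr := by
    intro m hm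
    obtain ⟨hmR, hsqf⟩ := mem_filter.mp hm
    rw [hR_def, mem_filter, mem_Icc] at hmR
    have hceil2 : 2 ≤ ⌈z⌉₊ := Nat.lt_ceil.mpr (by push_cast; linarith)
    refine ⟨hsqf, by omega, fun p hp => ?_⟩
    have hpp := Nat.prime_of_mem_primeFactors hp
    have hpm := Nat.dvd_of_mem_primeFactors hp
    have hm0 : 0 < m := by omega
    exact mem_primesGe.mpr ⟨hpp, le_of_dvd_of_coprime_primesProdBelow hpp hpm hmR.2,
      (Nat.le_of_dvd hm0 hpm).trans hmR.1.2⟩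
  have hsf : ∑ m ∈ R.filter Squarefree, g m ≤ C * Real.exp C * B' := by
    calc ∑ m ∈ R.filter Squarefree, g m = ∑ m ∈ R.filter Squarefree, f m :=
          sum_congr rfl fun m _ => (hf_apply m).symm
      _ ≤ ∏ p ∈ Pr, (1 + f p) - 1 :=
          sum_squarefree_le_prod_one_add_sub_one hf_mult
            (fun p _ => by rw [hf_apply]; exact hg0 p) hS
      _ = ∏ p ∈ Pr, (1 + g p) - 1 := by simp only [hf_apply]
      _ ≤ Real.exp (∑ p ∈ Pr, g p) - 1 := by
          linarith [prod_one_add_le_exp_sum (P := Pr) (f := g) (fun p _ => hg0 p)]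
      _ ≤ (∑ p ∈ Pr, g p) * Real.exp (∑ p ∈ Pr, g p) := by
          have h1 := Real.add_one_le_exp (-∑ p ∈ Pr, g p)
          have h2 : Real.exp (-∑ p ∈ Pr, g p) * Real.exp (∑ p ∈ Pr, g p) = 1 := by
            rw [← Real.exp_add]; simp
          nlinarith [Real.exp_pos (∑ p ∈ Pr, g p), Real.exp_pos (-∑ p ∈ Pr, g p)]
      _ ≤ (C * B') * Real.exp C := by
          have hCB : C * B' ≤ C := by
            have := mul_le_mul_of_nonneg_left hB'1 hC.le
            linarith
          exact mul_le_mul hSP (Real.exp_le_exp.mpr (hSP.trans hCB)) (Real.exp_pos _).le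
            (by positivity)
      _ = C * Real.exp C * B' := by ring
  have hnsf : ∑ m ∈ R.filter (fun m => ¬ Squarefree m), g m ≤ 6 * Real.exp 10 / z * L ^ 2 :=
    (sum_le_sum fun m _ => hgτ m).trans (sum_rough_not_squarefree_cardDivisors_div_le hz1 hY.le)
  have h1 : C * Real.exp C * B' ≤ (C * Real.exp C + 6 * Real.exp 10) * B' := by
    have : 0 ≤ 6 * Real.exp 10 * B' := by positivity
    nlinarith
  have h2 : 6 * Real.exp 10 / z * L ^ 2 ≤ (C * Real.exp C + 6 * Real.exp 10) * (1 / z * L ^ 2) := by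
    have h3 : 6 * Real.exp 10 / z * L ^ 2 = 6 * Real.exp 10 * (1 / z * L ^ 2) := by ring
    have h4 : 0 ≤ C * Real.exp C * (1 / z * L ^ 2) := by positivity
    rw [h3]; nlinarith
  calc ∑ m ∈ R, g m = _ := hsplit
    _ ≤ C * Real.exp C * B' + 6 * Real.exp 10 / z * L ^ 2 := add_le_add hsf hnsf
    _ ≤ (C * Real.exp C + 6 * Real.exp 10) * B' +
        (C * Real.exp C + 6 * Real.exp 10) * (1 / z * L ^ 2) := add_le_add h1 h2
    _ = (C * Real.exp C + 6 * Real.exp 10) * (B' + 1 / z * L ^ 2) := by ring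

end Literature.NumberTheory.LFunctions.SiegelZero
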